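import Literature.MathematicalPhysics.QuantumFieldTheory.Balaban1983to89.B7BlockAvgLog
import Literature.MathematicalPhysics.QuantumFieldTheory.Balaban1983to89.B7
import Literature.MathematicalPhysics.QuantumFieldTheory.Balaban1983to89.B8Ineq170

/-!
# Bałaban's renormalization group for 4-d lattice Yang–Mills — B7 Proposition 1 (51), the one-step regularity
estimate `|V̄(∂p′) − 1| < L²α₀ + C₀(L²α₀)²`, PROVED for the concrete block average (42) on `ℤ^d` with explicit
`C₀(d)`, `c₂′(d, L)` (`B7Prop1Explicit`)

CITATION HEADER (lean-in-tree rule 2026-08-18).  Audit cell `pub-balaban`, paper sub-cell B07 (unit b2b-balaban-b07,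
gen 13).  Source: T. Bałaban, *Averaging operations for lattice gauge theories*, Commun. Math. Phys. **98**, 17–51
(1985) [Balaban1985Averaging] (cell paper B7; journal page = PDF page + 16), Sect. B–C pp. 24–26 [PDF 8–10], quoted
from the page renders `b2b-balaban-ref1/pages/1985-cmp98-averaging/1985-cmp98-averaging-p008-x2.png`, `-p009-x2.png`,
`-p010-x2.png` READ AS IMAGES; the tree contours are those of T. Bałaban, *Propagators and renormalization
transformations for lattice gauge theories. I*, Commun. Math. Phys. **95**, 17–40 (1984) [Balaban1984PropagatorsI]
(cell paper B5), (1.6)–(1.8) p. 18 [PDF 2] (render `…/1984-cmp95-propagators-rt-I/…-p002-x2.png`).  Companions: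
`B7` (the quoted leaf `B7.Prop1Printed` and the abstract carrier `B7.OneStep`, which THIS FILE INSTANTIATES AND
PROVES), `MatrixLog` ((21)–(27): `log` = the series (21) `MatrixLog.mlog`; (26) `norm_mlog_le_two_mul`),
`B7Transfer` (conjugation and convex-combination lemmas), `B7Prop6Bound` (`|ab − 1| ≤ (1+|a−1|)(1+|b−1|) − 1`),
`B8Ineq170` (`|ab − 1| ≤ |a − 1| + |b − 1|` for `|a| ≤ 1`, reused — hence the import of a B8-side module; nothing of
paper B8 is used), `TiltedExponentMorseBounds` (`|e^B − 1 − B| ≤ e^{|B|} − 1 − |B|`).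

THE PRINTED TEXT (pp. 24–26).  "We assume that a configuration `V` defined on a unit lattice `Ω′` satisfies
`|V(∂p) − 1| < α₀, p ⊂ Ω′`, (44) and `α₀` sufficiently small. We would like to get optimal bounds for `|V̄(∂p′) − 1|`,
`p′ ⊂ Ω′^{(1)}`.  Let us denote by `y` the upper right corner of the plaquette `p′` and let us introduce locally the
axial gauge with the initial point `y`. This means that we take the contours `Γ_{y,x} = [y, (y₁, …, y_{d−1}, x_d)] ∪ …
∪ [(y₁, x₂, …, x_d), x]` … and we make a gauge transformation `v₀` such that the gauge transformed configuration
`V₀ = V^{v₀}` satisfies the conditions `V₀(Γ_{y,x}) = 1`. … Of course, we have `|V₀(∂p) − 1| = |V(∂p) − 1| < α₀`,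
`|V̄(∂p′) − 1| = |V̄₀(∂p′) − 1|`. (45)  The conditions `V₀(Γ_{y,x}) = 1` imply `V₀(x, x + e₁) = 1`,
`|V₀(x, x + e₂) − 1| < |x₁ − y₁|α₀`, …  If we denote `Δ(p′) = B(y₀) ∪ B(y₁) ∪ B(y₂) ∪ B(y)`, (46) then for `b ⊂ Δ(p′)`
we have `|V₀,b − 1| < |b₋ − y|α₀ ≤ dLα₀`, hence `V₀,b = e^{iA_b}` and `|A_b| < 2|b₋ − y|α₀ ≤ 2dLα₀`. For
`c ⊂ ∂p′`, the contours `Γ_{c,x}` are contained in `Δ(p′)` and we have `|V₀(Γ_{c,x}) − 1| ≤ Σ_{b ⊂ Γ_{c,x}} |V₀,b − 1|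
< |Γ_{c,x}| dLα₀ < (2d+1)LdLα₀ = O(1)L²α₀`, `|V₀(Γ_{c,x}) − 1 − iA(Γ_{c,x})| ≤ ½(|A|(Γ_{c,x}))² < O(1)(L²α₀)²`, so
using the definition (21) of the logarithmic function, we have `|(1/i) log V₀(Γ_{c,x} ∪ (−c)) − A(Γ_{c,x} ∪ (−c))|
< O(1)(L²α₀)²` for `L²α₀` sufficiently small. From this and (31) we get `V̄₀,c = exp[i Σ_{x∈B(c₋)} L^{−d}
A(Γ_{c,x} ∪ (−c)) + O((L²α₀)²)] · exp[iA(c) + O((L²α₀)²)] = exp[i Σ_{x∈B(c₋)} L^{−d} A(Γ_{c,x}) + O((L²α₀)²)]`, hence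
`|V̄₀,c − 1 − i Σ_{x∈B(c₋)} L^{−d} A(Γ_{c,x})| < O(1)(L²α₀)²`.  Now we can estimate `|V̄₀(∂p′) − 1|`. We have
`|V̄₀(∂p′) − 1 − i Σ_{c⊂∂p′} Σ_{x∈B(c₋)} L^{−d} A(Γ_{c,x})| < O(1)(L²α₀)²`. (47)  Denoting by `(p′)_x` a plaquette
obtained by translation of the plaquette `p′` to the point `x`, we have the identity `Σ_{c⊂∂p′} Σ_{x∈B(c₋)} L^{−d}
A(Γ_{c,x}) = Σ_{x∈B(y₀)} L^{−d} A(∂(p′)_x) = Σ_{x∈B(y₀)} L^{−d} Σ_{p⊂(p′)_x} A(∂p)`. (48)  Further, we have for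
`p ⊂ Δ(p′)` `|V₀(∂p) − 1 − iA(∂p)| < ½(|A|(∂p))² < ½(8dLα₀)² = O(1)L²α₀²`. (49)  Gathering together the above three
inequalities, we obtain `|V̄₀(∂p′) − 1| < Σ_{x∈B(y₀)} L^{−d} Σ_{p⊂(p′)_x} |A(∂p)| + O(1)(L²α₀)² < Σ L^{−d} Σ |V₀(∂p) − 1|
+ O(1)(L²α₀)² < L²α₀ + O(1)(L²α₀)²`. (50)  This is the estimate we are looking for. Let us notice that it is a local
result; the bound above depends on bounds for `V(∂p) − 1` on `Δ(p′)`, i.e., for `p ⊂ Δ(p′)`. We formulate the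
results in the following:  **Proposition 1.** There exist positive constants `C₀, c₂′` such that for every
configuration `V` satisfying (44) for `p ⊂ Δ(p′)` and for `α₀ ≤ c₂′`, we have `|V̄(∂p′) − 1| < L²α₀ + C₀(L²α₀)²`. (51)
The constant `C₀` depends on `d` and `c₂′` depends on `d` and `L`."  The average is (42) p. 23 [PDF 7] (= (15) p. 19):
"`Ū_c = exp[i Σ_{x∈B(c₋)} L^{−d} (1/i) log U(Γ_{c,x}) U(c)⁻¹] U(c)`", with (14) p. 19 "`Γ_{c,x} = Γ_{c₋,x} ∪ [x, x(c)]
∪ Γ_{x(c),c₊}`", `U(c) = U(Γ_c)`, `Γ_c` the straight contour from `c₋` to `c₊` (p. 20), `U(Γ) = U(x₀,x₁)U(x₁,x₂)…`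
(9) p. 18, `U(x′, x) = U(x, x′)⁻¹` (7), `U^u(x, x′) = u(x)U(x, x′)u(x′)⁻¹` (8), `\bar{U^u} = (Ū)^u` (11) p. 19,
and the tree contour of B5 (1.7) p. 18: "`Γ_{y,x} = [y, (y₁, …, y_{d−1}, x_d)] ∪ … ∪ [(y₁, …, y_μ, x_{μ+1}, …, x_d),
(y₁, …, x_μ, x_{μ+1}, …, x_d)] ∪ … ∪ [(y₁, x₂, …, x_d), x]`, (1.7) where `[x₁, x₂]` is a line segment connecting
points `x₁, x₂`. We consider `Γ_{y,x}`, and all other contours appearing in the paper, as oriented contours, with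
initial point `y` and final point `x`" (so from `y` the `d`-th coordinate is changed first, the first coordinate last).

DICTIONARY print ↦ Lean (all in this namespace; `𝔸` a complete normed `ℂ`-algebra with `‖1‖ = 1`, standing for
`M_N(ℂ)` with the operator norm (17); `G = U(N)` is replaced by the bigger set `U1 𝔸 = {u ∈ 𝔸ˣ : ‖u‖ ≤ 1, ‖u⁻¹‖ ≤ 1}`
— all that the proof uses of unitarity; the `i` of `e^{iA}` is absorbed into `A`).  Unit lattice `Ω′` ↦ `Site d = ℤ^d`
(`Fin d → ℤ`); oriented contour ↦ word `List (Letter d)`, `Letter d = Fin d × Bool` (`(μ, true)` = the step `+e_μ`);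
(9) `U(Γ)` ↦ `hol V x w` (ordered product, `(7)` built in: a backward letter contributes `V⁻¹`); (8) ↦ `gaugeAct`;
straight contour `Γ_c` ↦ `seg κ L`; B5 (1.7) `Γ_{y,x}` ↦ `treeWord (x − y)`; the axial gauge `v₀` ↦ `axialFn V y`
(`V₀ = gaugeAct (axialFn V y) V`, `hol_axial_treeWord : V₀(Γ_{y,x}) = 1`); (14) `Γ_{c,x}` ↦ `gammaWord L κ r`
(`x = c₋ + r`); `∂p` ↦ `plaqWord μ ν`; `B(c₋)` ↦ `r : Fin d → Fin L` via `boxVec`; (42) ↦ `Wcx` (the argument of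
`log`), `Xavg` (the exponent), `bavg L V q κ = V̄_c` for `c = ⟨q, q + Le_κ⟩`; `V̄(∂p′)` ↦ `cplaq L (bavg L V) y₀ μ ν`;
`A_b = (1/i) log V₀,b` ↦ `A x κ = mlog (V₀ x κ)`; `A(Γ)` ↦ `asum A x w`; `∂(p′)_x` ↦ `rectWord L L μ ν` based at `x`.

WHAT THIS FILE PROVES (kernel, no `sorry`, axioms `propext`, `Classical.choice`, `Quot.sound`).
* `prop1Printed_concrete : B7.Prop1Printed (L : ℝ) (concreteOneStep 𝔸 L)` — the quoted leaf of `B7.lean`, for the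
  family of all plaquettes `p′ = (y₀; μ ≠ ν)` of the `L`-lattice in `ℤ^d` (`L ≥ 1`), configurations with values in
  `U1 𝔸`, `plaqDev V = sup_p |V(∂p) − 1|` (over ALL unit plaquettes of `ℤ^d` — see DIVERGENCES (a)),
  `avgDev V = |V̄(∂p′) − 1|` for the average (42): WITH THE WITNESSES `C₀ = 226·(8(d+1)(d+4))² = 14464(d+1)²(d+4)²`
  and `c₂′ = 1/(512(d+1)(d+4)L²)` — "`C₀` depends on `d` and `c₂′` depends on `d` and `L`", as printed.
* `prop1_explicit` — the estimate itself: `V : ℤ^d → U1 𝔸`, `|V(∂p) − 1| ≤ α₀` for all unit plaquettes,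
  `512(d+1)(d+4)L²α₀ ≤ 1` ⟹ `|V̄(∂p′) − 1| ≤ L²α₀ + 226·(8(d+1)(d+4)L²α₀)²`; `prop1_core` — the same for a
  configuration `V₀` already in a gauge with `|V₀,b − 1| ≤ |b₋ − y|₁ α₀` near `y` (the printed axial-gauge situation).
* Every printed step as a separate declaration: (45)/(11) for the average, `bavg_gaugeAct` (`\bar{V^u}_c = u(c₋) V̄_c
  u(c₊)⁻¹`, via `mlog_units_conj` = "their logarithms are unitarily equivalent" and `exp_units_conj`) and `cplaq_conj`;
  the axial-gauge bond bound p. 24–25 in the form `|V₀,b − 1| ≤ |b₋ − y|₁·α₀` (`axial_bond_bound`, through the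
  non-abelian Stokes ladder `axial_bond_eq` / `ladder_bound`: the bond variable in the complete axial gauge is a product
  of `|b₋ − y|₁` conjugated plaquette variables); `|V₀(Γ) − 1| ≤ e^{|Γ|a} − 1`, `|V₀(Γ) − 1 − A(Γ)| ≤ ρ(|Γ|a)`,
  `ρ(t) = e^t − 1 − t` (`walk_linear`; print: `≤ ½(|A|(Γ))²` for hermitian `A` — here the Banach-algebra majorant);
  `|log W − (W − 1)| ≤ ρ(2|W − 1|)` (`norm_mlog_sub_le`, from (26)); the one-side expansion
  `|V̄₀,c − 1 − Σ_x L^{−d}A(Γ_{c,x})| ≤ 50θ²` and `|V̄₀,c − 1| ≤ 2θ`, `θ := 8(d+1)(d+4)L²α₀` (`side_estimate`); the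
  four-factor step (47) (`norm_prod4_sub_one_sub_le`); the identity (48) — corner cancellation
  `Σ_{c⊂∂p′} A(Γ_{c,x(c)}) = A(∂(p′)_x)` (`corner_cancellation`) and the abelian Stokes formula
  `A(∂R_{n×m}) = Σ_{p⊂R} A(∂p)` (`stokes`); (49)–(50) (`main_term_bound`: `|Σ_x L^{−d} A(∂(p′)_x)| ≤ L²(α₀ + ρ(4a))`).

METHOD = the printed proof, with every `O(1)` computed, and two simplifications.  (i) The hypothesis (44) is used
globally (DIVERGENCES (a)), so instead of the containment `Γ_{c,x} ⊂ Δ(p′)` the bookkeeping is by `l¹`-distance from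
`y`: every bond met lies within distance `R = (2d+4)L + 4` of `y`, where `|V₀,b − 1| ≤ Rα₀ ≤ a/2`,
`a := 4(d+4)Lα₀` (print: `2dLα₀`), and a contour of length `n` costs `na ≤ θ = 8(d+1)(d+4)L²α₀` (`n ≤ (2d+2)L` for
`Γ_{c,x} ∪ (−c)`).  (ii) The step "From this and (31)" (BCH) is bypassed: `V̄₀,c = e^{X_c}·V₀(c)` is expanded as a
PRODUCT (`|gh − 1 − (α+β)| ≤ |g−1||h−1| + |g−1−α| + |h−1−β|`), which gives the displayed
`|V̄₀,c − 1 − Σ L^{−d}A(Γ_{c,x})| < O(1)(L²α₀)²` directly, with `O(1)(L²α₀)² = 50θ²` (`16θ²` from `e^X − 1 − X`,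
`17θ²` from `log` and the contour expansion, `θ²` from `V₀(c)`, `16θ²` from the cross term); the inverse sides
`V̄₀,c⁻¹ = V₀(c)⁻¹e^{−X_c}` likewise.  Then (47) with `4·50θ² + (2θ)²(6 + 8θ + 4θ²) ≤ 225θ²`, (48) exactly, and
(49)–(50) with `L²ρ(4a) ≤ θ²`; total `226θ²`, under `θ ≤ 1/64`.  The strict `<` of (51) is obtained from the `≤`-version
at an intermediate `α₁ ∈ (plaqDev V, α₀)`.

DIVERGENCES / WHAT IS NOT REPRODUCED (cell GAPS.md D-b07g13.1).  (a) LOCALITY: Prop. 1 assumes (44) only "for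
`p ⊂ Δ(p′)`" (46); here (44) is assumed for all unit plaquettes of `ℤ^d` (as in the display (44) itself, "`p ⊂ Ω′`").
The proof given uses only plaquettes within `l¹`-distance `(2d+4)L + 8` of `y`, but this is not recorded in the
statement; the sharper printed locality (`Δ(p′)`, via `Γ_{c,x} ⊂ Δ(p′)`) is NOT certified here.  (b) SETTING: the whole
unit lattice `ℤ^d` for print's "a configuration `V` defined on a unit lattice `Ω′`" ((44) p. 24; in B7 the lattice is
"a subdomain `Ω` of the lattice `ηZ^d`" p. 17 with "`B^j(Ω^{(j)}) = Ω` for `j = 1, …, k`" (4) p. 18, and "The above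
definitions of bonds and plaquettes may be applied to an arbitrary lattice, e.g., to `Ω^{(j)}`" p. 18 — the word
"torus" is NOT printed in B7: v1's phrase "a torus or the whole space", attributed to p. 18, was a paraphrase and is
WITHDRAWN in v1.0.1); Prop. 1 is local ("Let us notice that it is a local result" p. 25), the shape of the lattice plays
no role in it; `G = U(N)` replaced by `U1 𝔸` in a complete normed `ℂ`-algebra with `‖1‖ = 1` (contains `U(N) ⊂ M_N(ℂ)`
with the operator norm (17)); in (45) only `|V₀(∂p) − 1| ≤ |V(∂p) − 1|` and `|V̄(∂p′) − 1| ≤ |V̄₀(∂p′) − 1|` are used (conjugation by elements of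
`U1 𝔸`), not the printed equalities.  (c) HYPOTHESIS with `≤ α₀` and conclusion with `≤` in `prop1_explicit`; the leaf
`Prop1Printed` (strict `<` both sides) is derived from it.  (d) CONSTANTS: the witnesses `C₀ = 14464(d+1)²(d+4)²`,
`c₂′ = 1/(512(d+1)(d+4)L²)` are admissible, not optimal (print: unspecified).  (e) Not touched: Prop. 2 (53)–(54)
(already `B7.prop2_of_ineq53`, which consumes (51) abstractly), Prop. 3, and the analyticity discussion.

FINDINGS OF THE AUDIT (cell GAPS.md C-b07g13-1; SMALLNESS census S-B7.15: `c₂′`, `C₀` of Prop. 1).  The printed proof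
of Proposition 1 is correct and complete at the level of detail given; every `O(1)` is finite and depends on `d` only
once `L²α₀` is the expansion parameter, exactly as claimed ("`C₀` depends on `d`, `c₂′` on `d` and `L`": the
smallness needed is `L²α₀ ≤ c(d)`, i.e. `c₂′ = c(d)/L²`).  Remarks: (1) the identity (48) silently uses that the
contour `Γ_{x(c),c₊}` in (14) is `Γ_{c₊,x(c)}` reversed and that the four tree systems at `y₀, y₁, y₂, y` are
translates of one another — with these conventions (built into `gammaWord`) the tree parts cancel in pairs around `∂p′`
(`corner_cancellation`, an identity of formal sums, no smallness); (2) the appeal to (31) is not needed for (51)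
(METHOD (ii)); (3) p. 24 "`|V₀(x, x + e₂) − 1| < |x₁ − y₁|α₀`" should read `≤` (both sides vanish for `x₁ = y₁`;
misprint list G-B7-08).  VALUE = the first kernel-checked THEOREM of the cell that is a numbered proposition of B7
proved for the paper's own concrete objects ((42) on the lattice), not an abstract restatement; it discharges the
hypothesis `Prop1Printed` of `B7.prop2_of_ineq53` for this concrete family.  NOT summit progress by itself (ultraviolet
stability needs Props. 2–3 and papers B8–B13).

VERSIONS.  v1 (b07 gen 13, p184276).  v1.0.1 (b07 gen 20, DOCSTRING-ONLY): divergence (b) SETTING re-sourced to the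
printed loci ((44) p. 24, p. 17, (4) p. 18; B7 prints no "torus" — the v1 paraphrase is withdrawn) and the page locators
of the `Site` / `boxVec` docstrings corrected ((44) p. 24 / (2) p. 17); prompted by the cell's CITATION POLICE finding
P-t4lit1g5-1 (GAPS A-t4lit1-4); no declaration, statement or proof changed.
-/

noncomputable section

open scoped BigOperators
open NormedSpace Finset

namespace Literature.MathematicalPhysics.QuantumFieldTheory.Balaban1983to89.B7Prop1Explicit

/-! ## §1 Words on `ℤ^d`, parallel transport (9), the abelian path functional -/

variable {d : ℕ}

/-- Sites of the unit lattice `ℤ^d` (print: "a unit lattice `Ω′`" (44) p. 24, the lattices being subdomains of "the lattice `ηZ^d`"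
p. 17; here the whole lattice at `η = 1` — Prop. 1 is local). [cite: Balaban1985Averaging, (44) p.24] -/
abbrev Site (d : ℕ) : Type := Fin d → ℤ

/-- A letter of a lattice word: a direction `μ` and an orientation (`true` = the step `+e_μ`). [folklore] -/
abbrev Letter (d : ℕ) : Type := Fin d × Bool

/-- The unit vector `e_μ`. [folklore] -/
def e (μ : Fin d) : Site d := Pi.single μ 1

/-- `e_apply`: lattice words and parallel transport (9) — bookkeeping. [folklore] -/
theorem e_apply (μ κ : Fin d) : e μ κ = if κ = μ then 1 else 0 := by
  simp [e, Pi.single_apply]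

namespace Letter

/-- The displacement `±e_μ` of a letter. [folklore] -/
def vec (l : Letter d) : Site d := if l.2 then e l.1 else -e l.1

/-- The reversed letter `∓e_μ`. [folklore] -/
def rev (l : Letter d) : Letter d := (l.1, !l.2)

/-- `rev_rev`: lattice words and parallel transport (9) — bookkeeping. [folklore] -/
@[simp] theorem rev_rev (l : Letter d) : l.rev.rev = l := by
  obtain ⟨μ, b⟩ := l; simp [rev]

/-- `vec_rev`: lattice words and parallel transport (9) — bookkeeping. [folklore] -/
@[simp] theorem vec_rev (l : Letter d) : l.rev.vec = -l.vec := by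
  obtain ⟨μ, b⟩ := l; cases b <;> simp [rev, vec]

/-- `rev_fst`: lattice words and parallel transport (9) — bookkeeping. [folklore] -/
@[simp] theorem rev_fst (l : Letter d) : l.rev.1 = l.1 := rfl

/-- `rev_snd`: lattice words and parallel transport (9) — bookkeeping. [folklore] -/
@[simp] theorem rev_snd (l : Letter d) : l.rev.2 = !l.2 := rfl

/-- `vec_true`: lattice words and parallel transport (9) — bookkeeping. [folklore] -/
@[simp] theorem vec_true (μ : Fin d) : Letter.vec ((μ, true) : Letter d) = e μ := rfl

/-- `vec_false`: lattice words and parallel transport (9) — bookkeeping. [folklore] -/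
@[simp] theorem vec_false (μ : Fin d) : Letter.vec ((μ, false) : Letter d) = -e μ := rfl

/-- `rev_mk`: lattice words and parallel transport (9) — bookkeeping. [folklore] -/
@[simp] theorem rev_mk (μ : Fin d) (b : Bool) : Letter.rev ((μ, b) : Letter d) = (μ, !b) := rfl

end Letter

/-- Net displacement of a word. [folklore] -/
def disp (w : List (Letter d)) : Site d := (w.map Letter.vec).sum

/-- `disp_nil`: lattice words and parallel transport (9) — bookkeeping. [folklore] -/
@[simp] theorem disp_nil : disp ([] : List (Letter d)) = 0 := by simp [disp]

/-- `disp_cons`: lattice words and parallel transport (9) — bookkeeping. [folklore] -/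
@[simp] theorem disp_cons (l : Letter d) (w : List (Letter d)) : disp (l :: w) = l.vec + disp w := by
  simp [disp]

/-- `disp_append`: lattice words and parallel transport (9) — bookkeeping. [folklore] -/
@[simp] theorem disp_append (w₁ w₂ : List (Letter d)) : disp (w₁ ++ w₂) = disp w₁ + disp w₂ := by
  simp [disp]

/-- `disp_flatMap`: lattice words and parallel transport (9) — bookkeeping. [folklore] -/
theorem disp_flatMap {ι : Type*} (s : List ι) (f : ι → List (Letter d)) :
    disp (s.flatMap f) = (s.map fun i => disp (f i)).sum := by
  induction s with
  | nil => simp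
  | cons i s ih => simp [List.flatMap_cons, ih]

/-- `disp_replicate`: lattice words and parallel transport (9) — bookkeeping. [folklore] -/
@[simp] theorem disp_replicate (n : ℕ) (l : Letter d) : disp (List.replicate n l) = (n : ℤ) • l.vec := by
  simp [disp, List.map_replicate, List.sum_replicate]

/-- The reversed word (the contour traversed backwards, `−Γ`). [folklore] -/
def revWord (w : List (Letter d)) : List (Letter d) := (w.map Letter.rev).reverse

/-- `revWord_nil`: lattice words and parallel transport (9) — bookkeeping. [folklore] -/
@[simp] theorem revWord_nil : revWord ([] : List (Letter d)) = [] := rfl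

/-- `revWord_cons`: lattice words and parallel transport (9) — bookkeeping. [folklore] -/
@[simp] theorem revWord_cons (l : Letter d) (w : List (Letter d)) : revWord (l :: w) = revWord w ++ [l.rev] := by
  simp [revWord]

/-- `revWord_append`: lattice words and parallel transport (9) — bookkeeping. [folklore] -/
@[simp] theorem revWord_append (w₁ w₂ : List (Letter d)) : revWord (w₁ ++ w₂) = revWord w₂ ++ revWord w₁ := by
  simp [revWord]

/-- `length_revWord`: lattice words and parallel transport (9) — bookkeeping. [folklore] -/
@[simp] theorem length_revWord (w : List (Letter d)) : (revWord w).length = w.length := by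
  simp [revWord]

/-- `disp_revWord`: lattice words and parallel transport (9) — bookkeeping. [folklore] -/
@[simp] theorem disp_revWord (w : List (Letter d)) : disp (revWord w) = -disp w := by
  induction w with
  | nil => simp
  | cons l w ih => simp [ih]

/-- `revWord_replicate`: lattice words and parallel transport (9) — bookkeeping. [folklore] -/
@[simp] theorem revWord_replicate (n : ℕ) (l : Letter d) : revWord (List.replicate n l) = List.replicate n l.rev := by
  simp [revWord, List.map_replicate]

/-- `mem_revWord`: lattice words and parallel transport (9) — bookkeeping. [folklore] -/
theorem mem_revWord {w : List (Letter d)} {l : Letter d} (h : l ∈ revWord w) : l.rev ∈ w := by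
  simp only [revWord, List.mem_reverse, List.mem_map] at h
  obtain ⟨l', hl', rfl⟩ := h
  simpa using hl'

section Transport

variable {G : Type*} [Group G]

/-- The bond variable traversed by the letter `l` from `x`: `V(x, x + e_μ)` for `+e_μ`, `V(x − e_μ, x)⁻¹` for `−e_μ`
(B7 (9): `U(−b) = U(b)⁻¹`). [cite: Balaban1985Averaging, (9) p.18] -/
def stepHol (V : Site d → Fin d → G) (x : Site d) (l : Letter d) : G :=
  if l.2 then V x l.1 else (V (x + l.vec) l.1)⁻¹

/-- **(9)** p. 19: parallel transport `V(Γ) = V(b₁) ⋯ V(b_n)` along the word spelled from `x`. [cite: Balaban1985Averaging, (9) p.18] -/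
def hol (V : Site d → Fin d → G) : Site d → List (Letter d) → G
  | _, [] => 1
  | x, l :: w => stepHol V x l * hol V (x + l.vec) w

/-- `hol_nil`: lattice words and parallel transport (9) — bookkeeping. [folklore] -/
@[simp] theorem hol_nil (V : Site d → Fin d → G) (x : Site d) : hol V x [] = 1 := rfl

/-- `hol_cons`: lattice words and parallel transport (9) — bookkeeping. [folklore] -/
@[simp] theorem hol_cons (V : Site d → Fin d → G) (x : Site d) (l : Letter d) (w : List (Letter d)) :
    hol V x (l :: w) = stepHol V x l * hol V (x + l.vec) w := rfl

/-- `stepHol_true`: lattice words and parallel transport (9) — bookkeeping. [folklore] -/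
theorem stepHol_true (V : Site d → Fin d → G) (x : Site d) (μ : Fin d) : stepHol V x (μ, true) = V x μ := rfl

/-- `stepHol_false`: lattice words and parallel transport (9) — bookkeeping. [folklore] -/
theorem stepHol_false (V : Site d → Fin d → G) (x : Site d) (μ : Fin d) :
    stepHol V x (μ, false) = (V (x - e μ) μ)⁻¹ := by
  simp [stepHol, Letter.vec, sub_eq_add_neg]

/-- `V(Γ₁ ∪ Γ₂) = V(Γ₁) V(Γ₂)`. [cite: Balaban1985Averaging, (9) p.18] -/
theorem hol_append (V : Site d → Fin d → G) : ∀ (x : Site d) (w₁ w₂ : List (Letter d)),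
    hol V x (w₁ ++ w₂) = hol V x w₁ * hol V (x + disp w₁) w₂
  | x, [], w₂ => by simp
  | x, l :: w₁, w₂ => by
    rw [List.cons_append, hol_cons, hol_cons, hol_append V (x + l.vec) w₁ w₂, disp_cons, mul_assoc, add_assoc]

/-- `stepHol_rev`: lattice words and parallel transport (9) — bookkeeping. [folklore] -/
theorem stepHol_rev (V : Site d → Fin d → G) (x : Site d) (l : Letter d) :
    stepHol V (x + l.vec) l.rev = (stepHol V x l)⁻¹ := by
  obtain ⟨μ, b⟩ := l
  cases b <;> simp [stepHol, Letter.rev, Letter.vec]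

/-- `V(−Γ) = V(Γ)⁻¹`. [cite: Balaban1985Averaging, (9) p.18] -/
theorem hol_revWord (V : Site d → Fin d → G) : ∀ (x : Site d) (w : List (Letter d)),
    hol V (x + disp w) (revWord w) = (hol V x w)⁻¹
  | x, [] => by simp
  | x, l :: w => by
    rw [revWord_cons, hol_append, disp_cons, show hol V x (l :: w) = stepHol V x l * hol V (x + l.vec) w from rfl,
      mul_inv_rev, show x + (l.vec + disp w) = (x + l.vec) + disp w by abel, hol_revWord V (x + l.vec) w, disp_revWord,
      show x + l.vec + disp w + -disp w = x + l.vec by abel]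
    simp [stepHol_rev]

/-- `hol_revWord'`: lattice words and parallel transport (9) — bookkeeping. [folklore] -/
theorem hol_revWord' (V : Site d → Fin d → G) {x : Site d} (p : Site d) (w : List (Letter d)) (hp : p = x + disp w) :
    hol V p (revWord w) = (hol V x w)⁻¹ := by
  subst hp; exact hol_revWord V x w

/-- **(8)** p. 18: the gauge transformation `V^u(x, x′) = u(x) V(x, x′) u(x′)⁻¹`. [cite: Balaban1985Averaging, (8) p.18] -/
def gaugeAct (u : Site d → G) (V : Site d → Fin d → G) : Site d → Fin d → G :=
  fun x μ => u x * V x μ * (u (x + e μ))⁻¹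

/-- `stepHol_gaugeAct`: lattice words and parallel transport (9) — bookkeeping. [folklore] -/
theorem stepHol_gaugeAct (u : Site d → G) (V : Site d → Fin d → G) (x : Site d) (l : Letter d) :
    stepHol (gaugeAct u V) x l = u x * stepHol V x l * (u (x + l.vec))⁻¹ := by
  obtain ⟨μ, b⟩ := l
  cases b
  · simp only [stepHol, gaugeAct, Letter.vec, Bool.false_eq_true, ↓reduceIte, mul_inv_rev, inv_inv,
      neg_add_cancel_right, mul_assoc]
  · simp [stepHol, gaugeAct, Letter.vec]

/-- (8) along a contour: `V^u(Γ) = u(Γ₋) V(Γ) u(Γ₊)⁻¹`. [cite: Balaban1985Averaging, (8) p.18] -/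
theorem hol_gaugeAct (u : Site d → G) (V : Site d → Fin d → G) : ∀ (x : Site d) (w : List (Letter d)),
    hol (gaugeAct u V) x w = u x * hol V x w * (u (x + disp w))⁻¹
  | x, [] => by simp
  | x, l :: w => by
    rw [hol_cons, hol_cons, stepHol_gaugeAct, hol_gaugeAct u V (x + l.vec) w, disp_cons, ← add_assoc]
    group

/-- Closed contours: `V^u(Γ) = u(x) V(Γ) u(x)⁻¹`. [cite: Balaban1985Averaging, (8) p.18] -/
theorem hol_gaugeAct_closed (u : Site d → G) (V : Site d → Fin d → G) (x : Site d) (w : List (Letter d))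
    (hw : disp w = 0) : hol (gaugeAct u V) x w = u x * hol V x w * (u x)⁻¹ := by
  rw [hol_gaugeAct, hw, add_zero]

/-! ### Straight segments, tree contours, plaquettes, ladders -/

/-- The straight segment of `n : ℤ` steps in direction `κ` (backwards for `n < 0`); for `n = L` this is the
contour `Γ_c` of the `L`-lattice bond `c = ⟨x, x + Le_κ⟩` (p. 20). [cite: Balaban1985Averaging, p.20] -/
def seg (κ : Fin d) : ℤ → List (Letter d)
  | Int.ofNat n => List.replicate n (κ, true)
  | Int.negSucc n => List.replicate (n + 1) (κ, false)

/-- `seg_natCast`: lattice words and parallel transport (9) — bookkeeping. [folklore] -/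
@[simp] theorem seg_natCast (κ : Fin d) (n : ℕ) : seg κ (n : ℤ) = List.replicate n (κ, true) := rfl

/-- `seg_zero`: lattice words and parallel transport (9) — bookkeeping. [folklore] -/
@[simp] theorem seg_zero (κ : Fin d) : seg κ 0 = [] := rfl

/-- `seg_neg_natCast`: lattice words and parallel transport (9) — bookkeeping. [folklore] -/
theorem seg_neg_natCast (κ : Fin d) (n : ℕ) : seg κ (-(n : ℤ)) = List.replicate n (κ, false) := by
  cases n with
  | zero => rfl
  | succ n => rfl

/-- `seg_negSucc`: lattice words and parallel transport (9) — bookkeeping. [folklore] -/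
theorem seg_negSucc (κ : Fin d) (n : ℕ) : seg κ (Int.negSucc n) = List.replicate (n + 1) (κ, false) := rfl

/-- `mem_seg`: lattice words and parallel transport (9) — bookkeeping. [folklore] -/
theorem mem_seg {κ : Fin d} {n : ℤ} {l : Letter d} (h : l ∈ seg κ n) : l.1 = κ := by
  cases n with
  | ofNat n => simp only [Int.ofNat_eq_natCast, seg_natCast, List.mem_replicate] at h; rw [h.2]
  | negSucc n => simp only [seg_negSucc, List.mem_replicate] at h; rw [h.2]

/-- `length_seg`: lattice words and parallel transport (9) — bookkeeping. [folklore] -/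
@[simp] theorem length_seg (κ : Fin d) (n : ℤ) : (seg κ n).length = n.natAbs := by
  cases n <;> simp [seg]

/-- `disp_seg`: lattice words and parallel transport (9) — bookkeeping. [folklore] -/
@[simp] theorem disp_seg (κ : Fin d) (n : ℤ) : disp (seg κ n) = n • e κ := by
  cases n with
  | ofNat n => simp [Letter.vec]
  | negSucc n =>
    simp only [seg_negSucc, disp_replicate, Letter.vec, Bool.false_eq_true, ↓reduceIte, smul_neg, ← neg_smul]
    rfl

/-- `revWord_seg`: lattice words and parallel transport (9) — bookkeeping. [folklore] -/
theorem revWord_seg (κ : Fin d) (n : ℤ) : revWord (seg κ n) = seg κ (-n) := by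
  cases n with
  | ofNat n => simp [Letter.rev, seg_neg_natCast]
  | negSucc n => rw [seg_negSucc, revWord_replicate, Int.neg_negSucc]; rfl

/-- `hol_seg_natCast_succ`: lattice words and parallel transport (9) — bookkeeping. [folklore] -/
theorem hol_seg_natCast_succ (V : Site d → Fin d → G) (z : Site d) (κ : Fin d) (n : ℕ) :
    hol V z (seg κ ((n : ℤ) + 1)) = hol V z (seg κ n) * V (z + (n : ℤ) • e κ) κ := by
  rw [show (n : ℤ) + 1 = ((n + 1 : ℕ) : ℤ) by push_cast; rfl, seg_natCast, seg_natCast,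
    List.replicate_succ', hol_append, disp_replicate]
  simp [stepHol, Letter.vec]

/-- `hol_seg_neg_succ`: lattice words and parallel transport (9) — bookkeeping. [folklore] -/
theorem hol_seg_neg_succ (V : Site d → Fin d → G) (z : Site d) (κ : Fin d) (m : ℕ) :
    hol V z (seg κ (-(m : ℤ))) = hol V z (seg κ (-((m + 1 : ℕ) : ℤ))) * V (z + (-((m + 1 : ℕ) : ℤ)) • e κ) κ := by
  have hs : z + (m : ℤ) • (-e κ : Site d) + (-e κ) = z + (-((m + 1 : ℕ) : ℤ)) • e κ := by
    ext ι; simp; ring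
  rw [seg_neg_natCast, seg_neg_natCast, List.replicate_succ', hol_append, disp_replicate, Letter.vec_false,
    hol_cons, hol_nil, mul_one, mul_assoc]
  unfold stepHol
  simp only [Bool.false_eq_true, ↓reduceIte, Letter.vec_false, hs, inv_mul_cancel, mul_one]

/-- `V` along `seg κ (n+1)` = `V` along `seg κ n` times the next bond variable (both signs of `n`). [folklore] -/
theorem hol_seg_succ (V : Site d → Fin d → G) (z : Site d) (κ : Fin d) (n : ℤ) :
    hol V z (seg κ (n + 1)) = hol V z (seg κ n) * V (z + n • e κ) κ := by
  rcases Int.eq_nat_or_neg n with ⟨m, rfl | rfl⟩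
  · exact hol_seg_natCast_succ V z κ m
  · cases m with
    | zero => simpa using hol_seg_natCast_succ V z κ 0
    | succ m =>
      rw [show -((m + 1 : ℕ) : ℤ) + 1 = -(m : ℤ) by push_cast; ring]
      exact hol_seg_neg_succ V z κ m

/-- **B5 (1.7) / B7 p. 24**: the tree contour `Γ_{y, y+v}` — the broken line from `y` to `y + v` changing the
coordinates one at a time in the order `d, d−1, …, 1` (B5 (1.7): "`Γ_{y,x} = [y, (y₁, …, y_{d−1}, x_d)] ∪ … ∪
[(y₁, x₂, …, x_d), x]`"). [cite: Balaban1985Averaging, p.24; Balaban1984PropagatorsI, (1.7) p.18] -/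
def treeWord (v : Site d) : List (Letter d) :=
  (List.finRange d).reverse.flatMap fun κ => seg κ (v κ)

/-- `treeWord_zero`: lattice words and parallel transport (9) — bookkeeping. [folklore] -/
@[simp] theorem treeWord_zero : treeWord (0 : Site d) = [] := by
  simp [treeWord]

/-- `sum_zsmul_e`: lattice words and parallel transport (9) — bookkeeping. [folklore] -/
theorem sum_zsmul_e (v : Site d) : ∑ κ, v κ • e κ = v := by
  ext ι
  simp [Finset.sum_apply, e_apply]

/-- `disp_treeWord`: lattice words and parallel transport (9) — bookkeeping. [folklore] -/
@[simp] theorem disp_treeWord (v : Site d) : disp (treeWord v) = v := by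
  rw [treeWord, disp_flatMap, List.map_reverse, List.sum_reverse]
  simp only [disp_seg]
  conv_rhs => rw [← sum_zsmul_e v]
  rw [Fin.sum_univ_def]

/-- The `ℓ¹` length `|v| = Σ_κ |v_κ|` (number of bonds of `Γ_{y,y+v}`). [folklore] -/
def l1 (v : Site d) : ℕ := ∑ κ, (v κ).natAbs

/-- `length_treeWord`: lattice words and parallel transport (9) — bookkeeping. [folklore] -/
@[simp] theorem length_treeWord (v : Site d) : (treeWord v).length = l1 v := by
  rw [treeWord, List.length_flatMap, List.map_reverse, List.sum_reverse, l1, Fin.sum_univ_def]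
  simp

/-- `l1_add_le`: lattice words and parallel transport (9) — bookkeeping. [folklore] -/
theorem l1_add_le (u v : Site d) : l1 (u + v) ≤ l1 u + l1 v := by
  unfold l1
  rw [← Finset.sum_add_distrib]
  exact Finset.sum_le_sum fun κ _ => Int.natAbs_add_le _ _

/-- `l1_neg`: lattice words and parallel transport (9) — bookkeeping. [folklore] -/
@[simp] theorem l1_neg (v : Site d) : l1 (-v) = l1 v := by
  simp [l1]

/-- `l1_vec`: lattice words and parallel transport (9) — bookkeeping. [folklore] -/
theorem l1_vec (l : Letter d) : l1 l.vec = 1 := by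
  obtain ⟨μ, b⟩ := l
  have : l1 (e μ : Site d) = 1 := by
    simp [l1, e_apply, apply_ite Int.natAbs]
  cases b <;> simp [Letter.vec, this]

/-- `l1_disp_le`: lattice words and parallel transport (9) — bookkeeping. [folklore] -/
theorem l1_disp_le (w : List (Letter d)) : l1 (disp w) ≤ w.length := by
  induction w with
  | nil => simp [l1]
  | cons l w ih =>
    rw [disp_cons, List.length_cons]
    calc l1 (l.vec + disp w) ≤ l1 l.vec + l1 (disp w) := l1_add_le _ _
      _ ≤ 1 + w.length := by rw [l1_vec]; omega
      _ = w.length + 1 := by ring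

/-- `l1_zsmul_e`: lattice words and parallel transport (9) — bookkeeping. [folklore] -/
theorem l1_zsmul_e (n : ℤ) (κ : Fin d) : l1 (n • e κ) = n.natAbs := by
  simp [l1, e_apply, apply_ite Int.natAbs]

/-- The plaquette contour `∂p`, `p` with lower corner at the base point, spanned by `e_κ, e_μ`. [cite: Balaban1985Averaging, (44) p.24] -/
def plaqWord (κ μ : Fin d) : List (Letter d) := [(κ, true), (μ, true), (κ, false), (μ, false)]

/-- The elementary loop spanned by a letter `l` and `+e_μ` (a plaquette, possibly traversed from another corner). [folklore] -/
def lplaqWord (l : Letter d) (μ : Fin d) : List (Letter d) := [l, (μ, true), l.rev, (μ, false)]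

/-- `lplaqWord_true`: lattice words and parallel transport (9) — bookkeeping. [folklore] -/
@[simp] theorem lplaqWord_true (κ μ : Fin d) : lplaqWord ((κ, true) : Letter d) μ = plaqWord κ μ := rfl

/-- `disp_plaqWord`: lattice words and parallel transport (9) — bookkeeping. [folklore] -/
@[simp] theorem disp_plaqWord (κ μ : Fin d) : disp (plaqWord κ μ : List (Letter d)) = 0 := by
  simp [plaqWord, Letter.vec]

/-- `disp_lplaqWord`: lattice words and parallel transport (9) — bookkeeping. [folklore] -/
@[simp] theorem disp_lplaqWord (l : Letter d) (μ : Fin d) : disp (lplaqWord l μ) = 0 := by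
  obtain ⟨κ, b⟩ := l
  cases b <;> simp [lplaqWord, Letter.vec]

/-- The ladder loop `Q ∪ [x, x+e_μ] ∪ (−Q − shifted) ∪ [w+e_μ, w]` used in the non-abelian Stokes estimate. [folklore] -/
def ladder (w : List (Letter d)) (μ : Fin d) : List (Letter d) := w ++ [(μ, true)] ++ revWord w ++ [(μ, false)]

/-- `hol_ladder`: lattice words and parallel transport (9) — bookkeeping. [folklore] -/
theorem hol_ladder (V : Site d → Fin d → G) (x : Site d) (w : List (Letter d)) (μ : Fin d) :
    hol V x (ladder w μ) = hol V x w * V (x + disp w) μ * (hol V (x + e μ) w)⁻¹ * (V x μ)⁻¹ := by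
  rw [ladder, hol_append, hol_append, hol_append]
  simp only [disp_append, disp_cons, disp_nil, add_zero, disp_revWord, hol_cons, hol_nil, mul_one, stepHol_true,
    stepHol_false, Letter.vec_true]
  rw [hol_revWord' V (x := x + e μ) _ w]
  · have hs : x + (disp w + e μ + -disp w) - e μ = x := by abel
    rw [hs]
  · abel

/-- `hol_lplaqWord`: lattice words and parallel transport (9) — bookkeeping. [folklore] -/
theorem hol_lplaqWord (V : Site d → Fin d → G) (x : Site d) (l : Letter d) (μ : Fin d) :
    hol V x (lplaqWord l μ) = stepHol V x l * V (x + l.vec) μ * (stepHol V (x + e μ) l)⁻¹ * (V x μ)⁻¹ := by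
  have h1 : stepHol V (x + l.vec + e μ) l.rev = (stepHol V (x + e μ) l)⁻¹ := by
    rw [show x + l.vec + e μ = (x + e μ) + l.vec by abel, stepHol_rev]
  simp only [lplaqWord, hol_cons, hol_nil, mul_one, Letter.vec_rev, Letter.vec_true, h1, stepHol_true, stepHol_false]
  rw [show x + l.vec + e μ + -l.vec - e μ = x by abel, mul_assoc, mul_assoc]

/-- The ladder recursion: `V(ladder (l :: Q)) = (g · V(ladder Q) · g⁻¹) · V(∂p_l)`, `g = V(l)`. [folklore] -/
theorem hol_ladder_cons (V : Site d → Fin d → G) (x : Site d) (l : Letter d) (w : List (Letter d)) (μ : Fin d) :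
    hol V x (ladder (l :: w) μ) =
      (stepHol V x l * hol V (x + l.vec) (ladder w μ) * (stepHol V x l)⁻¹) * hol V x (lplaqWord l μ) := by
  rw [hol_ladder, hol_ladder, hol_lplaqWord, hol_cons, hol_cons, disp_cons,
    show x + e μ + l.vec = x + l.vec + e μ by abel, ← add_assoc]
  group

/-- `mem_ladder`: lattice words and parallel transport (9) — bookkeeping. [folklore] -/
theorem mem_ladder {w : List (Letter d)} {μ : Fin d} {l : Letter d} (h : l ∈ ladder w μ) :
    l ∈ w ∨ l.rev ∈ w ∨ l.1 = μ := by
  simp only [ladder, List.append_assoc, List.mem_append, List.mem_cons, List.not_mem_nil, or_false] at h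
  rcases h with h | h | h | h
  · exact Or.inl h
  · exact Or.inr (Or.inr (by rw [h]))
  · exact Or.inr (Or.inl (mem_revWord h))
  · exact Or.inr (Or.inr (by rw [h]))

/-! ### The axial gauge of p. 24 -/

/-- p. 24: `v₀(x) := V(Γ_{y,x})` — the gauge transformation to the axial gauge based at `y`, so that
`V₀ := V^{v₀}` satisfies `V₀(Γ_{y,x}) = 1`. [cite: Balaban1985Averaging, p.24] -/
def axialFn (V : Site d → Fin d → G) (y : Site d) : Site d → G := fun x => hol V y (treeWord (x - y))

/-- p. 24: "the gauge transformed configuration `V₀ = V^{v₀}` satisfies the conditions `V₀(Γ_{y,x}) = 1`" — here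
`v₀ = axialFn V y` (the printed `v₀(x) = v₀(y)V(Γ_{y,x})` with `v₀(y) = 1`). [cite: Balaban1985Averaging, p.24] -/
theorem hol_axial_treeWord (V : Site d → Fin d → G) (y v : Site d) :
    hol (gaugeAct (axialFn V y) V) y (treeWord v) = 1 := by
  rw [hol_gaugeAct, disp_treeWord]
  simp [axialFn]

/-- `flatMap_congr_of`: lattice words and parallel transport (9) — bookkeeping. [folklore] -/
theorem flatMap_congr_of {ι : Type*} {f g : ι → List (Letter d)} :
    ∀ {s : List ι}, (∀ κ ∈ s, f κ = g κ) → s.flatMap f = s.flatMap g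
  | [], _ => rfl
  | κ :: s, h => by
    rw [List.flatMap_cons, List.flatMap_cons, h κ (by simp),
      flatMap_congr_of (s := s) fun κ' hκ' => h κ' (by simp [hκ'])]

/-- **The tree-gauge mechanism behind p. 24 l. −2 – p. 25 l. 3** ("The conditions `V₀(Γ_{y,x}) = 1` imply
`V₀(x, x + e₁) = 1`, `|V₀(x, x + e₂) − 1| < |x₁ − y₁|α₀`, …"; print gives no proof), made explicit: in the axial
gauge every bond variable `V₀(x, x + e_μ)` is conjugate, by a parallel transporter of `V₀`, to the holonomy of a
ladder loop over a sub-contour `Q` of `Γ_{y,x}` with `|Q| ≤ |x − y|₁` and no `e_μ`-bonds (a product of `|Q|`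
conjugated plaquette variables, `hol_ladder`). [cite: Balaban1985Averaging, pp.24–25] -/
theorem axial_bond_eq (V : Site d → Fin d → G) (y x : Site d) (μ : Fin d) :
    ∃ (w : Site d) (Q : List (Letter d)), (∀ l ∈ Q, l.1 ≠ μ) ∧ Q.length ≤ l1 (x - y) ∧
      gaugeAct (axialFn V y) V x μ =
        (hol (gaugeAct (axialFn V y) V) w Q)⁻¹ * hol (gaugeAct (axialFn V y) V) w (ladder Q μ) *
          hol (gaugeAct (axialFn V y) V) w Q := by
  obtain ⟨s, t, hst⟩ := List.append_of_mem (a := μ) (l := (List.finRange d).reverse) (by simp)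
  have hnd : (s ++ μ :: t).Nodup := by
    rw [← hst]; exact List.nodup_reverse.mpr (List.nodup_finRange d)
  have hμst : μ ∉ s ++ t := (List.nodup_cons.mp (List.nodup_middle.mp hnd)).1
  rw [List.mem_append, not_or] at hμst
  -- notation
  set V₀ := gaugeAct (axialFn V y) V with hV₀
  set v : Site d := x - y with hv
  let f : Fin d → List (Letter d) := fun κ => seg κ (v κ)
  have hne : ∀ κ, κ ≠ μ → seg κ ((v + e μ) κ) = f κ := by
    intro κ hκ; simp [f, e, hκ]
  have hμμ : seg μ ((v + e μ) μ) = seg μ (v μ + 1) := by simp [e]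
  have h1 : treeWord v = s.flatMap f ++ (seg μ (v μ) ++ t.flatMap f) := by
    rw [treeWord, hst, List.flatMap_append, List.flatMap_cons]
  have h2 : treeWord (v + e μ) = s.flatMap f ++ (seg μ (v μ + 1) ++ t.flatMap f) := by
    rw [treeWord, hst, List.flatMap_append, List.flatMap_cons, hμμ,
      flatMap_congr_of (s := s) (fun κ hκ => hne κ (fun h => hμst.1 (h ▸ hκ))),
      flatMap_congr_of (s := t) (fun κ hκ => hne κ (fun h => hμst.2 (h ▸ hκ)))]
  have ht1 := hol_axial_treeWord V y v
  have ht2 := hol_axial_treeWord V y (v + e μ)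
  rw [← hV₀] at ht1 ht2
  rw [h1, hol_append, hol_append] at ht1
  rw [h2, hol_append, hol_append, hol_seg_succ, disp_seg, add_smul, one_smul, ← add_assoc] at ht2
  set z := y + disp (s.flatMap f) with hz
  set w := z + v μ • e μ with hw
  set Q := t.flatMap f with hQ
  rw [disp_seg] at ht1
  refine ⟨w, Q, ?_, ?_, ?_⟩
  · intro l hl hlμ
    obtain ⟨κ, hκt, hlκ⟩ := List.mem_flatMap.mp hl
    have := mem_seg hlκ
    exact hμst.2 (by rwa [← hlμ, this])
  · have hlen : (treeWord v).length = (s.flatMap f).length + ((seg μ (v μ)).length + Q.length) := by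
      rw [h1, List.length_append, List.length_append]
    rw [length_treeWord] at hlen
    omega
  · have hx : w + disp Q = x := by
      have := disp_treeWord v
      rw [h1, disp_append, disp_append, disp_seg] at this
      rw [hw, hz, add_assoc, add_assoc, this, hv, add_sub_cancel]
    have h3 : hol V₀ w Q = V₀ w μ * hol V₀ (w + e μ) Q := by
      have := ht1.trans ht2.symm
      rw [mul_assoc] at this
      exact mul_left_cancel (mul_left_cancel this)
    rw [hol_ladder, hx, h3]
    group

end Transport

/-! ## §2 Norm-bounded units: conjugation, products, the ladder estimate, the bond bound of p. 24 -/

section NormedUnits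

variable {𝔸 : Type*} [NormedRing 𝔸] [NormOneClass 𝔸]

/-- The subgroup of units `u` with `‖u‖ ≤ 1` and `‖u⁻¹‖ ≤ 1` — contains `U(N) ⊂ M_N(ℂ)` (operator norm) and the
unitary group of every C⋆-algebra; the only property of the gauge group `G` used in the proof of Prop. 1.
[folklore] -/
def U1 (𝔸 : Type*) [NormedRing 𝔸] [NormOneClass 𝔸] : Subgroup 𝔸ˣ where
  carrier := {u | ‖(u : 𝔸)‖ ≤ 1 ∧ ‖((u⁻¹ : 𝔸ˣ) : 𝔸)‖ ≤ 1}
  mul_mem' := by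
    rintro u v ⟨hu, hu'⟩ ⟨hv, hv'⟩
    refine ⟨?_, ?_⟩
    · rw [Units.val_mul]
      exact (norm_mul_le _ _).trans (mul_le_one₀ hu (norm_nonneg _) hv)
    · rw [mul_inv_rev, Units.val_mul]
      exact (norm_mul_le _ _).trans (mul_le_one₀ hv' (norm_nonneg _) hu')
  one_mem' := by simp
  inv_mem' := by
    rintro u ⟨hu, hu'⟩
    exact ⟨hu', by simpa using hu⟩

/-- `mem_U1`: normed units — elementary estimate. [folklore] -/
theorem mem_U1 {u : 𝔸ˣ} : u ∈ U1 𝔸 ↔ ‖(u : 𝔸)‖ ≤ 1 ∧ ‖((u⁻¹ : 𝔸ˣ) : 𝔸)‖ ≤ 1 := Iff.rfl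

/-- `‖u⁻¹ − 1‖ ≤ ‖u − 1‖` for `‖u⁻¹‖ ≤ 1`. [folklore] -/
theorem norm_inv_sub_one_le {u : 𝔸ˣ} (h : u ∈ U1 𝔸) : ‖((u⁻¹ : 𝔸ˣ) : 𝔸) - 1‖ ≤ ‖(u : 𝔸) - 1‖ := by
  have : ((u⁻¹ : 𝔸ˣ) : 𝔸) - 1 = ((u⁻¹ : 𝔸ˣ) : 𝔸) * (1 - (u : 𝔸)) := by
    rw [mul_sub, mul_one, Units.inv_mul]
  rw [this]
  calc _ ≤ ‖((u⁻¹ : 𝔸ˣ) : 𝔸)‖ * ‖1 - (u : 𝔸)‖ := norm_mul_le _ _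
    _ ≤ 1 * ‖1 - (u : 𝔸)‖ := by gcongr; exact h.2
    _ = ‖(u : 𝔸) - 1‖ := by rw [one_mul, norm_sub_rev]

/-- `‖u X u⁻¹ − 1‖ ≤ ‖X − 1‖` for `u ∈ U1` (the tree's `B7Transfer.norm_conj_sub_one_le`). [folklore] -/
theorem norm_units_conj_sub_one_le {u : 𝔸ˣ} (h : u ∈ U1 𝔸) (X : 𝔸) :
    ‖(u : 𝔸) * X * ((u⁻¹ : 𝔸ˣ) : 𝔸) - 1‖ ≤ ‖X - 1‖ :=
  B7Transfer.norm_conj_sub_one_le _ X _ (Units.mul_inv u) h.1 h.2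

/-- `norm_units_inv_conj_sub_one_le`: normed units — elementary estimate. [folklore] -/
theorem norm_units_inv_conj_sub_one_le {u : 𝔸ˣ} (h : u ∈ U1 𝔸) (X : 𝔸) :
    ‖((u⁻¹ : 𝔸ˣ) : 𝔸) * X * (u : 𝔸) - 1‖ ≤ ‖X - 1‖ := by
  have := norm_units_conj_sub_one_le ((U1 𝔸).inv_mem h) X
  rwa [inv_inv] at this

/-- `stepHol_mem`: normed units — elementary estimate. [folklore] -/
theorem stepHol_mem {V : Site d → Fin d → 𝔸ˣ} (hV : ∀ x κ, V x κ ∈ U1 𝔸) (x : Site d) (l : Letter d) :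
    stepHol V x l ∈ U1 𝔸 := by
  unfold stepHol
  split_ifs
  exacts [hV _ _, (U1 𝔸).inv_mem (hV _ _)]

/-- `hol_mem`: normed units — elementary estimate. [folklore] -/
theorem hol_mem {V : Site d → Fin d → 𝔸ˣ} (hV : ∀ x κ, V x κ ∈ U1 𝔸) :
    ∀ (x : Site d) (w : List (Letter d)), hol V x w ∈ U1 𝔸
  | _, [] => (U1 𝔸).one_mem
  | x, l :: w => (U1 𝔸).mul_mem (stepHol_mem hV x l) (hol_mem hV _ w)

/-- `gaugeAct_mem`: normed units — elementary estimate. [folklore] -/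
theorem gaugeAct_mem {V : Site d → Fin d → 𝔸ˣ} (hV : ∀ x κ, V x κ ∈ U1 𝔸) {u : Site d → 𝔸ˣ}
    (hu : ∀ x, u x ∈ U1 𝔸) (x : Site d) (κ : Fin d) : gaugeAct u V x κ ∈ U1 𝔸 :=
  (U1 𝔸).mul_mem ((U1 𝔸).mul_mem (hu x) (hV x κ)) ((U1 𝔸).inv_mem (hu _))

/-- `axialFn_mem`: normed units — elementary estimate. [folklore] -/
theorem axialFn_mem {V : Site d → Fin d → 𝔸ˣ} (hV : ∀ x κ, V x κ ∈ U1 𝔸) (y x : Site d) :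
    axialFn V y x ∈ U1 𝔸 :=
  hol_mem hV _ _

/-- **Non-abelian Stokes estimate (ladder form)**: if every elementary loop spanned by a letter `κ ≠ μ` and `e_μ`
deviates from `1` by at most `α`, the ladder loop over a word `Q` without `e_μ`-letters deviates by at most
`|Q| α` — the estimate behind "`|V₀,b − 1| < |b₋ − y|α₀`" (p. 25 l. 3). [folklore] -/
theorem ladder_bound (V : Site d → Fin d → 𝔸ˣ) (hV : ∀ x κ, V x κ ∈ U1 𝔸) (μ : Fin d) {α : ℝ}
    (hP : ∀ (x : Site d) (l : Letter d), l.1 ≠ μ → ‖((hol V x (lplaqWord l μ) : 𝔸ˣ) : 𝔸) - 1‖ ≤ α) :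
    ∀ (w : List (Letter d)) (x : Site d), (∀ l ∈ w, l.1 ≠ μ) →
      ‖((hol V x (ladder w μ) : 𝔸ˣ) : 𝔸) - 1‖ ≤ w.length * α
  | [], _x, _ => by simp [ladder, stepHol_true, stepHol_false]
  | l :: w, x, hw => by
    rw [hol_ladder_cons, Units.val_mul, List.length_cons, Nat.cast_succ, add_mul, one_mul]
    have ih := ladder_bound V hV μ hP w (x + l.vec) fun l' hl' => hw l' (List.mem_cons_of_mem l hl')
    have hl := hP x l (hw l (by simp))
    have hg := stepHol_mem hV x l
    have hconj : ‖((stepHol V x l * hol V (x + l.vec) (ladder w μ) * (stepHol V x l)⁻¹ : 𝔸ˣ) : 𝔸) - 1‖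
        ≤ ‖((hol V (x + l.vec) (ladder w μ) : 𝔸ˣ) : 𝔸) - 1‖ := by
      rw [Units.val_mul, Units.val_mul]
      exact norm_units_conj_sub_one_le hg _
    have hn1 : ‖((stepHol V x l * hol V (x + l.vec) (ladder w μ) * (stepHol V x l)⁻¹ : 𝔸ˣ) : 𝔸)‖ ≤ 1 :=
      (mem_U1.mp ((U1 𝔸).mul_mem ((U1 𝔸).mul_mem hg (hol_mem hV _ _)) ((U1 𝔸).inv_mem hg))).1
    calc _ ≤ _ + _ := B8Ineq170.norm_mul_sub_one_le_of_norm_le_one hn1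
      _ ≤ w.length * α + α := add_le_add (hconj.trans ih) hl

/-- The elementary loop of a backward letter `−e_κ` is the inverse plaquette at `x − e_κ` conjugated by a bond
variable, so it obeys the same bound (44). [folklore] -/
theorem norm_hol_lplaqWord_sub_one_le (V : Site d → Fin d → 𝔸ˣ) (hV : ∀ x κ, V x κ ∈ U1 𝔸) {α : ℝ}
    (h44 : ∀ (x : Site d) (κ μ : Fin d), κ ≠ μ → ‖((hol V x (plaqWord κ μ) : 𝔸ˣ) : 𝔸) - 1‖ ≤ α)
    (x : Site d) (l : Letter d) (μ : Fin d) (hl : l.1 ≠ μ) :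
    ‖((hol V x (lplaqWord l μ) : 𝔸ˣ) : 𝔸) - 1‖ ≤ α := by
  obtain ⟨κ, b⟩ := l
  cases b
  · -- backward letter: conjugated inverse plaquette at `x - e κ`
    have hid : hol V x (lplaqWord (κ, false) μ) =
        (V (x - e κ) κ)⁻¹ * (hol V (x - e κ) (plaqWord κ μ))⁻¹ * V (x - e κ) κ := by
      simp only [lplaqWord, plaqWord, hol_cons, hol_nil, mul_one, stepHol_true, stepHol_false, Letter.rev_mk,
        Bool.not_false, Letter.vec_true, Letter.vec_false, mul_inv_rev, inv_inv]
      abel_nf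
      group
    rw [hid, Units.val_mul, Units.val_mul]
    refine (norm_units_inv_conj_sub_one_le (hV _ _) _).trans ?_
    exact (norm_inv_sub_one_le (hol_mem hV _ _)).trans (h44 _ κ μ hl)
  · exact h44 x κ μ hl

/-- **pp. 24–25, the bond bound in the axial gauge**: "for `b ⊂ Δ(p′)` we have `|V₀,b − 1| < |b₋ − y|α₀`"
(p. 25 l. 3) — here with `≤` (cf. misprint list: equality `0` occurs), for every bond `b = ⟨x, x + e_μ⟩` of `ℤ^d`,
`|x − y|₁` the `ℓ¹` distance, assuming (44) for all unit plaquettes. [cite: Balaban1985Averaging, pp.24–25] -/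
theorem axial_bond_bound (V : Site d → Fin d → 𝔸ˣ) (hV : ∀ x κ, V x κ ∈ U1 𝔸) (y : Site d) {α : ℝ}
    (h44 : ∀ (x : Site d) (κ μ : Fin d), κ ≠ μ → ‖((hol V x (plaqWord κ μ) : 𝔸ˣ) : 𝔸) - 1‖ ≤ α) (hα : 0 ≤ α)
    (x : Site d) (μ : Fin d) :
    ‖((gaugeAct (axialFn V y) V x μ : 𝔸ˣ) : 𝔸) - 1‖ ≤ l1 (x - y) * α := by
  set V₀ := gaugeAct (axialFn V y) V with hV₀
  have hV₀m : ∀ x κ, V₀ x κ ∈ U1 𝔸 := gaugeAct_mem hV (axialFn_mem hV y)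
  obtain ⟨w, Q, hQμ, hQlen, hid⟩ := axial_bond_eq V y x μ
  rw [← hV₀] at hid
  have hP : ∀ (x : Site d) (l : Letter d), l.1 ≠ μ → ‖((hol V₀ x (lplaqWord l μ) : 𝔸ˣ) : 𝔸) - 1‖ ≤ α := by
    intro x l hl
    rw [hV₀, hol_gaugeAct_closed _ _ _ _ (disp_lplaqWord l μ), Units.val_mul, Units.val_mul]
    exact (norm_units_conj_sub_one_le (axialFn_mem hV y x) _).trans
      (norm_hol_lplaqWord_sub_one_le V hV h44 x l μ hl)
  have hlad := ladder_bound V₀ hV₀m μ hP Q w hQμ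
  rw [hid, Units.val_mul, Units.val_mul]
  refine (norm_units_inv_conj_sub_one_le (hol_mem hV₀m _ _) _).trans (hlad.trans ?_)
  exact mul_le_mul_of_nonneg_right (by exact_mod_cast hQlen) hα

end NormedUnits

/-! ## §3 Linearisation: `V(Γ) − 1` versus `A(Γ) = Σ_{b ⊂ Γ} A_b`, the logarithm, products

The complex-algebra replacement of the `g`-valued bond field of p. 25 l. 3 ("hence `V₀,b = e^{iA_b}`"):
`A_b := log V₀,b` (the `i` absorbed) and the abelian path functional `A(Γ) = Σ_{b⊂Γ} A_b`.  All remainders are controlled by `ρ(t) = e^t − 1 − t`. -/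

section Linear

/-- `ρ(t) = e^t − 1 − t`, the universal second-order remainder. [folklore] -/
def expRem (t : ℝ) : ℝ := Real.exp t - 1 - t

/-- `expRem_nonneg`: linearisation — elementary bookkeeping. [folklore] -/
theorem expRem_nonneg (t : ℝ) : 0 ≤ expRem t := by
  have := Real.add_one_le_exp t; unfold expRem; linarith

/-- `expRem_mono`: linearisation — elementary bookkeeping. [folklore] -/
theorem expRem_mono {s t : ℝ} (hs : 0 ≤ s) (hst : s ≤ t) : expRem s ≤ expRem t := by
  unfold expRem
  have h2 : Real.exp s * (t - s) ≤ Real.exp s * (Real.exp (t - s) - 1) := by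
    apply mul_le_mul_of_nonneg_left _ (Real.exp_pos s).le
    have := Real.add_one_le_exp (t - s); linarith
  have h3 : Real.exp s * Real.exp (t - s) = Real.exp t := by rw [← Real.exp_add]; ring_nf
  have h4 : 1 ≤ Real.exp s := Real.one_le_exp hs
  nlinarith [h2, h3, h4, sub_nonneg.mpr hst]

/-- `expRem_le_sq`: linearisation — elementary bookkeeping. [folklore] -/
theorem expRem_le_sq {t : ℝ} (h0 : 0 ≤ t) (h1 : t ≤ 1) : expRem t ≤ t ^ 2 := by
  have := Real.abs_exp_sub_one_sub_id_le (x := t) (by rwa [abs_of_nonneg h0])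
  unfold expRem; exact (le_abs_self _).trans this

/-- `expRem_add`: linearisation — elementary bookkeeping. [folklore] -/
theorem expRem_add (a b : ℝ) : expRem (a + b) = (Real.exp a - 1) * (Real.exp b - 1) + expRem a + expRem b := by
  unfold expRem; rw [Real.exp_add]; ring

/-- `exp_mul_exp_sub_one`: linearisation — elementary bookkeeping. [folklore] -/
theorem exp_mul_exp_sub_one (a b : ℝ) :
    (1 + (Real.exp a - 1)) * (1 + (Real.exp b - 1)) - 1 = Real.exp (a + b) - 1 := by
  rw [Real.exp_add]; ring

variable {𝔸 : Type*} [NormedRing 𝔸] [NormOneClass 𝔸] [NormedAlgebra ℂ 𝔸] [CompleteSpace 𝔸]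

omit [NormOneClass 𝔸] [NormedAlgebra ℂ 𝔸] [CompleteSpace 𝔸] in
/-- `‖gh − 1 − (α + β)‖ ≤ ‖g − 1‖‖h − 1‖ + ‖g − 1 − α‖ + ‖h − 1 − β‖`. [folklore] -/
theorem norm_mul_sub_one_sub_le (g h α β : 𝔸) :
    ‖g * h - 1 - (α + β)‖ ≤ ‖g - 1‖ * ‖h - 1‖ + ‖g - 1 - α‖ + ‖h - 1 - β‖ := by
  have : g * h - 1 - (α + β) = (g - 1) * (h - 1) + (g - 1 - α) + (h - 1 - β) := by noncomm_ring
  rw [this]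
  calc _ ≤ ‖(g - 1) * (h - 1) + (g - 1 - α)‖ + ‖h - 1 - β‖ := norm_add_le _ _
    _ ≤ ‖(g - 1) * (h - 1)‖ + ‖g - 1 - α‖ + ‖h - 1 - β‖ := by gcongr; exact norm_add_le _ _
    _ ≤ _ := by gcongr; exact norm_mul_le _ _

omit [NormOneClass 𝔸] in
/-- `‖e^B − 1‖ ≤ e^{‖B‖} − 1` and `‖e^B − 1 − B‖ ≤ ρ(‖B‖)` (tree lemmas), monotone in a bound `‖B‖ ≤ a`. [folklore] -/
theorem norm_exp_sub_one_le_of_norm_le {B : 𝔸} {a : ℝ} (h : ‖B‖ ≤ a) :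
    ‖exp B - 1‖ ≤ Real.exp a - 1 ∧ ‖exp B - 1 - B‖ ≤ expRem a :=
  ⟨B7Transfer.norm_exp_sub_one_le_of_le B h,
    (OneLinkLaplace.norm_exp_sub_one_sub_le B).trans (expRem_mono (norm_nonneg _) h)⟩

omit [NormOneClass 𝔸] in
/-- `e^X` as a unit, with inverse `e^{−X}`. [folklore] -/
noncomputable def expUnit (X : 𝔸) : 𝔸ˣ where
  val := exp X
  inv := exp (-X)
  val_inv := by
    letI : NormedAlgebra ℚ 𝔸 := NormedAlgebra.restrictScalars ℚ ℂ 𝔸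
    rw [← exp_add_of_commute (Commute.refl X).neg_right, add_neg_cancel, exp_zero]
  inv_val := by
    letI : NormedAlgebra ℚ 𝔸 := NormedAlgebra.restrictScalars ℚ ℂ 𝔸
    rw [← exp_add_of_commute (Commute.refl X).neg_left, neg_add_cancel, exp_zero]

omit [NormOneClass 𝔸] in
/-- `val_expUnit`: linearisation — elementary bookkeeping. [folklore] -/
@[simp] theorem val_expUnit (X : 𝔸) : (expUnit X : 𝔸) = exp X := rfl

omit [NormOneClass 𝔸] in
/-- `val_inv_expUnit`: linearisation — elementary bookkeeping. [folklore] -/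
@[simp] theorem val_inv_expUnit (X : 𝔸) : ((expUnit X)⁻¹ : 𝔸ˣ) = expUnit (-X) := by
  ext; rfl

omit [NormOneClass 𝔸] in
/-- `units_val_inv_eq_exp_neg`: linearisation — elementary bookkeeping. [folklore] -/
theorem units_val_inv_eq_exp_neg {g : 𝔸ˣ} {B : 𝔸} (h : (g : 𝔸) = exp B) : ((g⁻¹ : 𝔸ˣ) : 𝔸) = exp (-B) := by
  have : g = expUnit B := Units.ext h
  rw [this]; rfl

/-! ### The abelian path functional `A(Γ)` -/

/-- The contribution `± A_b` of a letter. [folklore] -/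
def stepA (A : Site d → Fin d → 𝔸) (x : Site d) (l : Letter d) : 𝔸 :=
  if l.2 then A x l.1 else -A (x + l.vec) l.1

/-- `A(Γ) = Σ_{b ⊂ Γ} A_b` (p. 24, with orientation signs). [cite: Balaban1985Averaging, p.24] -/
def asum (A : Site d → Fin d → 𝔸) : Site d → List (Letter d) → 𝔸
  | _, [] => 0
  | x, l :: w => stepA A x l + asum A (x + l.vec) w

omit [NormOneClass 𝔸] [NormedAlgebra ℂ 𝔸] [CompleteSpace 𝔸] in
/-- `asum_nil`: linearisation — elementary bookkeeping. [folklore] -/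
@[simp] theorem asum_nil (A : Site d → Fin d → 𝔸) (x : Site d) : asum A x [] = 0 := rfl

omit [NormOneClass 𝔸] [NormedAlgebra ℂ 𝔸] [CompleteSpace 𝔸] in
/-- `asum_cons`: linearisation — elementary bookkeeping. [folklore] -/
@[simp] theorem asum_cons (A : Site d → Fin d → 𝔸) (x : Site d) (l : Letter d) (w : List (Letter d)) :
    asum A x (l :: w) = stepA A x l + asum A (x + l.vec) w := rfl

omit [NormOneClass 𝔸] [NormedAlgebra ℂ 𝔸] [CompleteSpace 𝔸] in
/-- `stepA_true`: linearisation — elementary bookkeeping. [folklore] -/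
theorem stepA_true (A : Site d → Fin d → 𝔸) (x : Site d) (μ : Fin d) : stepA A x (μ, true) = A x μ := rfl

omit [NormOneClass 𝔸] [NormedAlgebra ℂ 𝔸] [CompleteSpace 𝔸] in
/-- `stepA_false`: linearisation — elementary bookkeeping. [folklore] -/
theorem stepA_false (A : Site d → Fin d → 𝔸) (x : Site d) (μ : Fin d) :
    stepA A x (μ, false) = -A (x - e μ) μ := by
  simp [stepA, sub_eq_add_neg]

omit [NormOneClass 𝔸] [NormedAlgebra ℂ 𝔸] [CompleteSpace 𝔸] in
/-- `asum_append`: linearisation — elementary bookkeeping. [folklore] -/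
theorem asum_append (A : Site d → Fin d → 𝔸) : ∀ (x : Site d) (w₁ w₂ : List (Letter d)),
    asum A x (w₁ ++ w₂) = asum A x w₁ + asum A (x + disp w₁) w₂
  | x, [], w₂ => by simp
  | x, l :: w₁, w₂ => by
    rw [List.cons_append, asum_cons, asum_cons, asum_append A (x + l.vec) w₁ w₂, disp_cons, add_assoc, add_assoc]

omit [NormOneClass 𝔸] [NormedAlgebra ℂ 𝔸] [CompleteSpace 𝔸] in
/-- `stepA_rev`: linearisation — elementary bookkeeping. [folklore] -/
theorem stepA_rev (A : Site d → Fin d → 𝔸) (x : Site d) (l : Letter d) :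
    stepA A (x + l.vec) l.rev = -stepA A x l := by
  obtain ⟨μ, b⟩ := l
  cases b <;> simp [stepA, Letter.rev, Letter.vec]

omit [NormOneClass 𝔸] [NormedAlgebra ℂ 𝔸] [CompleteSpace 𝔸] in
/-- `A(−Γ) = −A(Γ)`. [folklore] -/
theorem asum_revWord (A : Site d → Fin d → 𝔸) : ∀ (x : Site d) (w : List (Letter d)),
    asum A (x + disp w) (revWord w) = -asum A x w
  | x, [] => by simp
  | x, l :: w => by
    rw [revWord_cons, asum_append, disp_cons, show asum A x (l :: w) = stepA A x l + asum A (x + l.vec) w from rfl,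
      neg_add, show x + (l.vec + disp w) = (x + l.vec) + disp w by abel, asum_revWord A (x + l.vec) w, disp_revWord,
      show x + l.vec + disp w + -disp w = x + l.vec by abel]
    simp [stepA_rev, add_comm]

omit [NormOneClass 𝔸] [NormedAlgebra ℂ 𝔸] [CompleteSpace 𝔸] in
/-- `asum_revWord'`: linearisation — elementary bookkeeping. [folklore] -/
theorem asum_revWord' (A : Site d → Fin d → 𝔸) {x : Site d} (p : Site d) (w : List (Letter d))
    (hp : p = x + disp w) : asum A p (revWord w) = -asum A x w := by
  subst hp; exact asum_revWord A x w

/-! ### `V(Γ) − 1 − A(Γ)` along a word inside the region where `V_b = e^{A_b}`, `‖A_b‖ ≤ a` -/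

omit [NormOneClass 𝔸] in
/-- One letter: `V(l) = e^{±A_b}` with `‖±A_b‖ ≤ a`. [folklore] -/
theorem stepHol_eq_exp_stepA (V : Site d → Fin d → 𝔸ˣ) (A : Site d → Fin d → 𝔸) (y : Site d) (R : ℕ)
    {a : ℝ} (hVA : ∀ x κ, l1 (x - y) ≤ R → ((V x κ : 𝔸ˣ) : 𝔸) = exp (A x κ) ∧ ‖A x κ‖ ≤ a)
    (x : Site d) (l : Letter d) (hx : l1 (x - y) + 1 ≤ R) :
    ((stepHol V x l : 𝔸ˣ) : 𝔸) = exp (stepA A x l) ∧ ‖stepA A x l‖ ≤ a := by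
  have hb : l1 (x + l.vec - y) ≤ R := by
    have := l1_add_le (x - y) l.vec
    rw [l1_vec, show x - y + l.vec = x + l.vec - y by abel] at this
    omega
  obtain ⟨μ, b⟩ := l
  cases b
  · obtain ⟨h1, h2⟩ := hVA (x + Letter.vec (μ, false)) μ hb
    refine ⟨?_, ?_⟩
    · simp only [stepHol, Bool.false_eq_true, ↓reduceIte, stepA]
      exact units_val_inv_eq_exp_neg h1
    · simpa [stepA] using h2
  · obtain ⟨h1, h2⟩ := hVA x μ (by omega)
    exact ⟨by simpa [stepHol, stepA] using h1, by simpa [stepA] using h2⟩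

omit [NormOneClass 𝔸] in
/-- **p. 25, the expansion of one parallel transporter**: along a word `Γ` of length `n` inside the region where
`V_b = exp A_b`, `‖A_b‖ ≤ a`: `‖V(Γ) − 1‖ ≤ e^{na} − 1` and `‖V(Γ) − 1 − A(Γ)‖ ≤ ρ(na)`, `ρ(t) = e^t − 1 − t` — the
kernel form of "`|V₀(Γ_{c,x}) − 1 − iA(Γ_{c,x})| ≤ ½(|A|(Γ_{c,x}))² < O(1)(L²α₀)²`" (print: hermitian `A`, unitary
factors; here the Banach-algebra majorant). [cite: Balaban1985Averaging, p.25 (displays before (47))] -/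
theorem walk_linear (V : Site d → Fin d → 𝔸ˣ) (A : Site d → Fin d → 𝔸) (y : Site d) (R : ℕ) {a : ℝ}
    (ha : 0 ≤ a) (hVA : ∀ x κ, l1 (x - y) ≤ R → ((V x κ : 𝔸ˣ) : 𝔸) = exp (A x κ) ∧ ‖A x κ‖ ≤ a) :
    ∀ (w : List (Letter d)) (x : Site d), l1 (x - y) + w.length ≤ R →
      ‖((hol V x w : 𝔸ˣ) : 𝔸) - 1‖ ≤ Real.exp (w.length * a) - 1 ∧
        ‖((hol V x w : 𝔸ˣ) : 𝔸) - 1 - asum A x w‖ ≤ expRem (w.length * a)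
  | [], x, _ => by simp [expRem]
  | l :: w, x, hx => by
    rw [List.length_cons] at hx
    obtain ⟨hg, hB⟩ := stepHol_eq_exp_stepA V A y R hVA x l (by omega)
    have hx' : l1 (x + l.vec - y) + w.length ≤ R := by
      have := l1_add_le (x - y) l.vec
      rw [l1_vec, show x - y + l.vec = x + l.vec - y by abel] at this
      omega
    obtain ⟨ih1, ih2⟩ := walk_linear V A y R ha hVA w (x + l.vec) hx'
    obtain ⟨hg1, hg2⟩ := norm_exp_sub_one_le_of_norm_le hB
    rw [← hg] at hg1 hg2
    rw [hol_cons, Units.val_mul, asum_cons, List.length_cons, Nat.cast_succ,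
      show ((w.length : ℝ) + 1) * a = a + w.length * a by ring]
    refine ⟨?_, ?_⟩
    · refine (B7Prop6Bound.mul_sub_one_norm_le _ _).trans ?_
      rw [← exp_mul_exp_sub_one]
      have h1 : 0 ≤ Real.exp a - 1 := by have := Real.one_le_exp ha; linarith
      have h2 : 0 ≤ Real.exp (w.length * a) - 1 := by
        have := Real.one_le_exp (by positivity : 0 ≤ (w.length : ℝ) * a); linarith
      gcongr
    · refine (norm_mul_sub_one_sub_le _ _ _ _).trans ?_
      rw [expRem_add]
      have h1 : 0 ≤ Real.exp a - 1 := by have := Real.one_le_exp ha; linarith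
      gcongr

/-! ### The logarithm to second order, and its gauge covariance -/

omit [NormOneClass 𝔸] in
/-- `‖log W − (W − 1)‖ ≤ ρ(2‖W − 1‖)` for `‖W − 1‖ ≤ ½` — from (26) `|log W| ≤ 2|W − 1|` and
`W − 1 − log W = e^{log W} − 1 − log W`. [cite: Balaban1985Averaging, (26)–(27) p.21] -/
theorem norm_mlog_sub_le {W : 𝔸} (hW : ‖W - 1‖ ≤ 1 / 2) :
    ‖MatrixLog.mlog W - (W - 1)‖ ≤ expRem (2 * ‖W - 1‖) := by
  have hW1 : ‖W - 1‖ < 1 := by linarith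
  have hZ := MatrixLog.norm_mlog_le_two_mul hW
  have h := OneLinkLaplace.norm_exp_sub_one_sub_le (MatrixLog.mlog W)
  rw [MatrixLog.exp_mlog hW1] at h
  rw [norm_sub_rev]
  exact h.trans (expRem_mono (norm_nonneg _) hZ)

/-- **(11)/(23) for the logarithm**: `log (u X u⁻¹) = u (log X) u⁻¹` for `‖u‖, ‖u⁻¹‖ ≤ 1`, `|X − 1| < 1`
(termwise conjugation of the series (21)). [cite: Balaban1985Averaging, (21)–(23) p.21] -/
theorem mlog_units_conj {u : 𝔸ˣ} (hu : u ∈ U1 𝔸) {X : 𝔸} (hX : ‖X - 1‖ < 1) :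
    MatrixLog.mlog ((u : 𝔸) * X * ((u⁻¹ : 𝔸ˣ) : 𝔸)) = (u : 𝔸) * MatrixLog.mlog X * ((u⁻¹ : 𝔸ˣ) : 𝔸) := by
  have hc : (u : 𝔸) * X * ((u⁻¹ : 𝔸ˣ) : 𝔸) - 1 = (u : 𝔸) * (X - 1) * ((u⁻¹ : 𝔸ˣ) : 𝔸) := by
    rw [mul_sub, sub_mul, mul_one, Units.mul_inv]
  have hX' : ‖(u : 𝔸) * X * ((u⁻¹ : 𝔸ˣ) : 𝔸) - 1‖ < 1 := by
    rw [hc]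
    calc _ ≤ ‖(u : 𝔸) * (X - 1)‖ * ‖((u⁻¹ : 𝔸ˣ) : 𝔸)‖ := norm_mul_le _ _
      _ ≤ (‖(u : 𝔸)‖ * ‖X - 1‖) * 1 := by gcongr; exacts [norm_mul_le _ _, hu.2]
      _ ≤ (1 * ‖X - 1‖) * 1 := by gcongr; exact hu.1
      _ < 1 := by simpa using hX
  have h1 := MatrixLog.hasSum_mlog hX'
  have h2 := ((MatrixLog.hasSum_mlog hX).mul_left (u : 𝔸)).mul_right ((u⁻¹ : 𝔸ˣ) : 𝔸)
  have h3 : (fun n : ℕ => Literature.Analysis.Complex.logSeriesCoeff n • ((u : 𝔸) * X * ((u⁻¹ : 𝔸ˣ) : 𝔸) - 1) ^ n)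
      = fun n : ℕ => (u : 𝔸) * (Literature.Analysis.Complex.logSeriesCoeff n • (X - 1) ^ n) * ((u⁻¹ : 𝔸ˣ) : 𝔸) := by
    funext n
    rw [hc, Units.conj_pow, mul_smul_comm, smul_mul_assoc]
  rw [h3] at h1
  exact h1.unique h2

end Linear

/-! ## §4 The block average (42) on the bonds of the `L`-lattice, its gauge covariance (45)/(11) -/

section Average

variable {𝔸 : Type*} [NormedRing 𝔸] [NormOneClass 𝔸] [NormedAlgebra ℂ 𝔸] [CompleteSpace 𝔸]
variable (L : ℕ)

/-- The offset `x − y ∈ [0, L)^d` of a point of the corner block `B(y) = {x : y_μ ≤ x_μ < y_μ + L}` ((2) p. 17 on the unit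
lattice; B5 (1.6)). [cite: Balaban1985Averaging, (2) p.17] -/
def boxVec (r : Fin d → Fin L) : Site d := fun κ => ((r κ : ℕ) : ℤ)

/-- `l1_boxVec_le`: the block average (42) — bookkeeping. [folklore] -/
theorem l1_boxVec_le (r : Fin d → Fin L) : l1 (boxVec L r) ≤ d * L := by
  unfold l1 boxVec
  calc ∑ κ, (((r κ : ℕ) : ℤ)).natAbs ≤ ∑ _κ : Fin d, L := Finset.sum_le_sum fun κ _ => by
          rw [Int.natAbs_natCast]; exact (r κ).isLt.le
    _ = d * L := by simp

/-- **(14)** p. 19: the contour `Γ_{c,x} = Γ_{c₋,x} ∪ [x, x(c)] ∪ Γ_{x(c),c₊}` of the `L`-bond `c = ⟨q, q + Le_κ⟩`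
and the point `x = q + r ∈ B(c₋)`, `x(c) = x + Le_κ` (B5 (1.8)); the last piece is `Γ_{c₊,x(c)}` reversed.
[cite: Balaban1985Averaging, (14) p.19] -/
def gammaWord (κ : Fin d) (r : Site d) : List (Letter d) := treeWord r ++ seg κ L ++ revWord (treeWord r)

omit [NormOneClass 𝔸] [NormedAlgebra ℂ 𝔸] [CompleteSpace 𝔸] in
/-- `disp_gammaWord`: the block average (42) — bookkeeping. [folklore] -/
theorem disp_gammaWord (κ : Fin d) (r : Site d) : disp (gammaWord L κ r) = (L : ℤ) • e κ := by
  simp only [gammaWord, disp_append, disp_treeWord, disp_seg, disp_revWord]; abel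

omit [NormOneClass 𝔸] [NormedAlgebra ℂ 𝔸] [CompleteSpace 𝔸] in
/-- `length_gammaWord`: the block average (42) — bookkeeping. [folklore] -/
theorem length_gammaWord (κ : Fin d) (r : Site d) : (gammaWord L κ r).length = 2 * l1 r + L := by
  simp only [gammaWord, List.length_append, length_treeWord, length_seg, length_revWord, Int.natAbs_natCast]
  ring

/-- **(42)**, the argument of `log`: `V(Γ_{c,x}) V(c)⁻¹` (`V(c) = V(Γ_c)`, `Γ_c` the straight contour (9)). [cite: Balaban1985Averaging, (42) p.23] -/
def Wcx (V : Site d → Fin d → 𝔸ˣ) (q : Site d) (κ : Fin d) (r : Site d) : 𝔸ˣ :=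
  hol V q (gammaWord L κ r) * (hol V q (seg κ L))⁻¹

omit [NormOneClass 𝔸] [NormedAlgebra ℂ 𝔸] [CompleteSpace 𝔸] in
/-- `V(Γ_{c,x}) V(c)⁻¹` is the holonomy of the closed contour `Γ_{c,x} ∪ (−Γ_c)`. [cite: Balaban1985Averaging, (42) p.23] -/
theorem Wcx_eq_hol_loop (V : Site d → Fin d → 𝔸ˣ) (q : Site d) (κ : Fin d) (r : Site d) :
    Wcx L V q κ r = hol V q (gammaWord L κ r ++ seg κ (-(L : ℤ))) := by
  rw [Wcx, hol_append, disp_gammaWord, ← revWord_seg, hol_revWord' V (x := q) _ _ (by rw [disp_seg])]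

/-- **(42)**, the exponent: `X_c := Σ_{x ∈ B(c₋)} L^{−d} log [V(Γ_{c,x}) V(c)⁻¹]`. [cite: Balaban1985Averaging, (42) p.23] -/
def Xavg (V : Site d → Fin d → 𝔸ˣ) (q : Site d) (κ : Fin d) : 𝔸 :=
  ∑ r : Fin d → Fin L, (((L : ℝ) ^ d)⁻¹) • MatrixLog.mlog ((Wcx L V q κ (boxVec L r) : 𝔸ˣ) : 𝔸)

/-- **(42)**: `V̄_c := exp[Σ_{x ∈ B(c₋)} L^{−d} log V(Γ_{c,x}) V(c)⁻¹] · V(c)`, the averaged configuration on the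
bonds `c = ⟨q, q + Le_κ⟩` of the `L`-lattice (indexed by `(q, κ)`). [cite: Balaban1985Averaging, (42) p.23] -/
def bavg (V : Site d → Fin d → 𝔸ˣ) : Site d → Fin d → 𝔸ˣ := fun q κ => expUnit (Xavg L V q κ) * hol V q (seg κ L)

/-- The plaquette variable of side `L`: `W(∂p′) = W(z, μ) W(z + Le_μ, ν) W(z + Le_ν, μ)⁻¹ W(z, ν)⁻¹` for the
plaquette `p′` of the `L`-lattice with lower-left corner `z` spanned by `e_μ, e_ν`. [cite: Balaban1985Averaging, (44) p.24] -/
def cplaq (W : Site d → Fin d → 𝔸ˣ) (z : Site d) (μ ν : Fin d) : 𝔸ˣ :=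
  W z μ * W (z + (L : ℤ) • e μ) ν * (W (z + (L : ℤ) • e ν) μ)⁻¹ * (W z ν)⁻¹

omit [NormOneClass 𝔸] [NormedAlgebra ℂ 𝔸] [CompleteSpace 𝔸] in
/-- For `L = 1` the coarse plaquette variable is the plaquette holonomy `V(∂p)` of (44). [folklore] -/
theorem cplaq_one (V : Site d → Fin d → 𝔸ˣ) (z : Site d) (μ ν : Fin d) :
    cplaq 1 V z μ ν = hol V z (plaqWord μ ν) := by
  simp only [cplaq, Nat.cast_one, one_smul, plaqWord, hol_cons, hol_nil, mul_one, stepHol_true, stepHol_false,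
    Letter.vec_true, Letter.vec_false]
  abel_nf
  simp only [mul_assoc]

/-! ### (45): gauge covariance of the average, `\bar{V^u}_c = u(c₋) V̄_c u(c₊)⁻¹` -/

omit [NormOneClass 𝔸] [NormedAlgebra ℂ 𝔸] [CompleteSpace 𝔸] in
/-- `Wcx_gaugeAct`: the block average (42) — bookkeeping. [folklore] -/
theorem Wcx_gaugeAct (u : Site d → 𝔸ˣ) (V : Site d → Fin d → 𝔸ˣ) (q : Site d) (κ : Fin d) (r : Site d) :
    Wcx L (gaugeAct u V) q κ r = u q * Wcx L V q κ r * (u q)⁻¹ := by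
  unfold Wcx
  rw [hol_gaugeAct, hol_gaugeAct, disp_seg, disp_gammaWord]
  group

/-- (45) for the exponent of (42): `X_c[V^u] = u(c₋) X_c[V] u(c₋)⁻¹` (inside the analyticity domain of `log`).
[cite: Balaban1985Averaging, (45) p.24] -/
theorem Xavg_gaugeAct {u : Site d → 𝔸ˣ} (hu : ∀ x, u x ∈ U1 𝔸) (V : Site d → Fin d → 𝔸ˣ) (q : Site d)
    (κ : Fin d) (hW : ∀ r : Fin d → Fin L, ‖((Wcx L V q κ (boxVec L r) : 𝔸ˣ) : 𝔸) - 1‖ < 1) :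
    Xavg L (gaugeAct u V) q κ = (u q : 𝔸) * Xavg L V q κ * ((u q)⁻¹ : 𝔸ˣ) := by
  unfold Xavg
  rw [Finset.mul_sum, Finset.sum_mul]
  refine Finset.sum_congr rfl fun r _ => ?_
  rw [Wcx_gaugeAct, Units.val_mul, Units.val_mul, mlog_units_conj (hu q) (hW r), mul_smul_comm, smul_mul_assoc]

/-- **(45)** p. 24 (= (11) for the average (42)): `\bar{V^u}_c = u(c₋) V̄_c u(c₊)⁻¹`, inside the analyticity
domain. [cite: Balaban1985Averaging, (45) p.24] -/
theorem bavg_gaugeAct {u : Site d → 𝔸ˣ} (hu : ∀ x, u x ∈ U1 𝔸) (V : Site d → Fin d → 𝔸ˣ) (q : Site d)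
    (κ : Fin d) (hW : ∀ r : Fin d → Fin L, ‖((Wcx L V q κ (boxVec L r) : 𝔸ˣ) : 𝔸) - 1‖ < 1) :
    bavg L (gaugeAct u V) q κ = u q * bavg L V q κ * (u (q + (L : ℤ) • e κ))⁻¹ := by
  letI : NormedAlgebra ℚ 𝔸 := NormedAlgebra.restrictScalars ℚ ℂ 𝔸
  apply Units.ext
  simp only [bavg, Units.val_mul, val_expUnit]
  rw [Xavg_gaugeAct L hu V q κ hW, hol_gaugeAct, disp_seg, exp_units_conj, Units.val_mul, Units.val_mul]
  simp only [mul_assoc, Units.inv_mul_cancel_left]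

omit [NormOneClass 𝔸] [NormedAlgebra ℂ 𝔸] [CompleteSpace 𝔸] in
/-- A coarse plaquette variable of a gauge-transformed coarse configuration is the conjugate. [folklore] -/
theorem cplaq_conj (u : Site d → 𝔸ˣ) (W W' : Site d → Fin d → 𝔸ˣ) (z : Site d) (μ ν : Fin d)
    (h₁ : W' z μ = u z * W z μ * (u (z + (L : ℤ) • e μ))⁻¹)
    (h₂ : W' (z + (L : ℤ) • e μ) ν = u (z + (L : ℤ) • e μ) * W (z + (L : ℤ) • e μ) ν
      * (u (z + (L : ℤ) • e μ + (L : ℤ) • e ν))⁻¹)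
    (h₃ : W' (z + (L : ℤ) • e ν) μ = u (z + (L : ℤ) • e ν) * W (z + (L : ℤ) • e ν) μ
      * (u (z + (L : ℤ) • e ν + (L : ℤ) • e μ))⁻¹)
    (h₄ : W' z ν = u z * W z ν * (u (z + (L : ℤ) • e ν))⁻¹) :
    cplaq L W' z μ ν = u z * cplaq L W z μ ν * (u z)⁻¹ := by
  simp only [cplaq, h₁, h₂, h₃, h₄]
  rw [show z + (L : ℤ) • e μ + (L : ℤ) • e ν = z + (L : ℤ) • e ν + (L : ℤ) • e μ by abel]
  group

end Average

/-! ## §5 The first-order identity (48): corner cancellation and the abelian Stokes formula -/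

section FirstOrder

variable {𝔸 : Type*} [NormedRing 𝔸]
variable (L : ℕ)

/-- The boundary of the `n × m` rectangle with lower-left corner at the base point, spanned by `e_μ, e_ν`;
for `n = m = L` this is `∂(p′)_x` of (48). [cite: Balaban1985Averaging, (48) p.25] -/
def rectWord (n m : ℕ) (μ ν : Fin d) : List (Letter d) :=
  seg μ n ++ seg ν m ++ seg μ (-(n : ℤ)) ++ seg ν (-(m : ℤ))

/-- `asum_seg_succ`: the abelian path functional — bookkeeping identity. [folklore] -/
theorem asum_seg_succ (A : Site d → Fin d → 𝔸) (p : Site d) (κ : Fin d) (n : ℕ) :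
    asum A p (seg κ ((n + 1 : ℕ) : ℤ)) = asum A p (seg κ n) + A (p + (n : ℤ) • e κ) κ := by
  rw [seg_natCast, seg_natCast, List.replicate_succ', asum_append, disp_replicate]
  simp [stepA_true]

/-- `A([p, p + n e_κ]) = Σ_{i<n} A(p + i e_κ, κ)`. [folklore] -/
theorem asum_seg_natCast (A : Site d → Fin d → 𝔸) (p : Site d) (κ : Fin d) :
    ∀ n : ℕ, asum A p (seg κ n) = ∑ i ∈ Finset.range n, A (p + (i : ℤ) • e κ) κ
  | 0 => by simp
  | n + 1 => by rw [asum_seg_succ, asum_seg_natCast A p κ n, Finset.sum_range_succ]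

/-- `asum_seg_neg`: the abelian path functional — bookkeeping identity. [folklore] -/
theorem asum_seg_neg (A : Site d → Fin d → 𝔸) (p : Site d) (κ : Fin d) (n : ℕ) :
    asum A p (seg κ (-(n : ℤ))) = -asum A (p - (n : ℤ) • e κ) (seg κ n) := by
  rw [← revWord_seg, asum_revWord' A (x := p - (n : ℤ) • e κ) _ _ (by rw [disp_seg]; abel)]

/-- The four terms of the contour sum of one averaged bond: `A(Γ_{c,x}) = A(Γ_{c₋,x}) + A([x, x(c)]) − A(Γ_{c₊,x(c)})`.
[cite: Balaban1985Averaging, (14) p.19] -/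
theorem asum_gammaWord (A : Site d → Fin d → 𝔸) (q : Site d) (κ : Fin d) (r : Site d) :
    asum A q (gammaWord L κ r) =
      asum A q (treeWord r) + asum A (q + r) (seg κ L) - asum A (q + (L : ℤ) • e κ) (treeWord r) := by
  rw [gammaWord, asum_append, asum_append, disp_append, disp_treeWord, disp_seg,
    asum_revWord' A (x := q + (L : ℤ) • e κ) _ _ (by rw [disp_treeWord]; abel), sub_eq_add_neg]

/-- `asum_rectWord`: the abelian path functional — bookkeeping identity. [folklore] -/
theorem asum_rectWord (A : Site d → Fin d → 𝔸) (p : Site d) (n m : ℕ) (μ ν : Fin d) :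
    asum A p (rectWord n m μ ν) = asum A p (seg μ n) + asum A (p + (n : ℤ) • e μ) (seg ν m)
      - asum A (p + (m : ℤ) • e ν) (seg μ n) - asum A p (seg ν m) := by
  rw [rectWord, asum_append, asum_append, asum_append]
  simp only [disp_append, disp_seg, asum_seg_neg, neg_smul]
  rw [show p + ((n : ℤ) • e μ + (m : ℤ) • e ν) - (n : ℤ) • e μ = p + (m : ℤ) • e ν by abel,
    show p + ((n : ℤ) • e μ + (m : ℤ) • e ν + -((n : ℤ) • e μ)) - (m : ℤ) • e ν = p by abel]
  abel

/-- **(48), first equality** — the corner cancellation: summing `A(Γ_{c,x})` over the four oriented sides of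
`p′` (each built by the same recipe from its own corner block), the tree contributions cancel and
`Σ_{c ⊂ ∂p′} A(Γ_{c,x(c)}) = A(∂(p′)_x)`, `(p′)_x = p′ + (x − y₀)`. [cite: Balaban1985Averaging, (48) p.25] -/
theorem corner_cancellation (A : Site d → Fin d → 𝔸) (z r : Site d) (μ ν : Fin d) :
    asum A z (gammaWord L μ r) + asum A (z + (L : ℤ) • e μ) (gammaWord L ν r)
      - asum A (z + (L : ℤ) • e ν) (gammaWord L μ r) - asum A z (gammaWord L ν r)
      = asum A (z + r) (rectWord L L μ ν) := by
  simp only [asum_gammaWord, asum_rectWord]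
  rw [show z + (L : ℤ) • e μ + r = z + r + (L : ℤ) • e μ by abel,
    show z + (L : ℤ) • e ν + r = z + r + (L : ℤ) • e ν by abel,
    show z + (L : ℤ) • e ν + (L : ℤ) • e μ = z + (L : ℤ) • e μ + (L : ℤ) • e ν by abel]
  abel

/-- `asum_plaqWord`: the abelian path functional — bookkeeping identity. [folklore] -/
theorem asum_plaqWord (A : Site d → Fin d → 𝔸) (p : Site d) (μ ν : Fin d) :
    asum A p (plaqWord μ ν) = A p μ + A (p + e μ) ν - A (p + e ν) μ - A p ν := by
  simp only [plaqWord, asum_cons, asum_nil, stepA_true, stepA_false, Letter.vec_true, Letter.vec_false]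
  rw [show p + e μ + e ν - e μ = p + e ν by abel, show p + e μ + e ν + -e μ - e ν = p by abel]
  abel

/-- **(48), second equality** — the abelian Stokes formula: `A(∂R) = Σ_{p ⊂ R} A(∂p)` for the `n × m` rectangle.
[cite: Balaban1985Averaging, (48) p.25] -/
theorem stokes (A : Site d → Fin d → 𝔸) (p : Site d) (n m : ℕ) (μ ν : Fin d) :
    asum A p (rectWord n m μ ν) =
      ∑ i ∈ Finset.range n, ∑ j ∈ Finset.range m, asum A (p + (i : ℤ) • e μ + (j : ℤ) • e ν) (plaqWord μ ν) := by
  simp only [asum_plaqWord, asum_rectWord, asum_seg_natCast]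
  have h1 : ∀ i ∈ Finset.range n, ∑ j ∈ Finset.range m,
      (A (p + (i : ℤ) • e μ + (j : ℤ) • e ν) μ + A (p + (i : ℤ) • e μ + (j : ℤ) • e ν + e μ) ν
        - A (p + (i : ℤ) • e μ + (j : ℤ) • e ν + e ν) μ - A (p + (i : ℤ) • e μ + (j : ℤ) • e ν) ν)
      = (A (p + (i : ℤ) • e μ) μ - A (p + (m : ℤ) • e ν + (i : ℤ) • e μ) μ)
        + ∑ j ∈ Finset.range m, (A (p + ((i + 1 : ℕ) : ℤ) • e μ + (j : ℤ) • e ν) ν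
            - A (p + (i : ℤ) • e μ + (j : ℤ) • e ν) ν) := by
    intro i _
    have ht : ∑ j ∈ Finset.range m,
        (A (p + (i : ℤ) • e μ + (j : ℤ) • e ν) μ - A (p + (i : ℤ) • e μ + ((j + 1 : ℕ) : ℤ) • e ν) μ)
        = A (p + (i : ℤ) • e μ + ((0 : ℕ) : ℤ) • e ν) μ - A (p + (i : ℤ) • e μ + (m : ℤ) • e ν) μ :=
      Finset.sum_range_sub' (fun j => A (p + (i : ℤ) • e μ + (j : ℤ) • e ν) μ) m
    rw [Nat.cast_zero, zero_smul, add_zero, show p + (i : ℤ) • e μ + (m : ℤ) • e ν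
      = p + (m : ℤ) • e ν + (i : ℤ) • e μ by abel] at ht
    rw [← ht, ← Finset.sum_add_distrib]
    refine Finset.sum_congr rfl fun j _ => ?_
    rw [show p + (i : ℤ) • e μ + (j : ℤ) • e ν + e μ = p + ((i + 1 : ℕ) : ℤ) • e μ + (j : ℤ) • e ν by
          simp only [Nat.cast_succ, add_smul, one_smul]; abel,
      show p + (i : ℤ) • e μ + (j : ℤ) • e ν + e ν = p + (i : ℤ) • e μ + ((j + 1 : ℕ) : ℤ) • e ν by
          simp only [Nat.cast_succ, add_smul, one_smul]; abel]
    abel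
  rw [Finset.sum_congr rfl h1, Finset.sum_add_distrib, Finset.sum_sub_distrib, Finset.sum_comm]
  have h2 : ∀ j ∈ Finset.range m, ∑ i ∈ Finset.range n,
      (A (p + ((i + 1 : ℕ) : ℤ) • e μ + (j : ℤ) • e ν) ν - A (p + (i : ℤ) • e μ + (j : ℤ) • e ν) ν)
      = A (p + (n : ℤ) • e μ + (j : ℤ) • e ν) ν - A (p + (j : ℤ) • e ν) ν := by
    intro j _
    have := Finset.sum_range_sub (fun i => A (p + (i : ℤ) • e μ + (j : ℤ) • e ν) ν) n
    simpa using this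
  rw [Finset.sum_congr rfl h2, Finset.sum_sub_distrib]
  abel

end FirstOrder

/-! ## §6 Estimates, and the proof of Proposition 1 (51) with explicit constants -/

section Estimates

variable {𝔸 : Type*} [NormedRing 𝔸] [NormOneClass 𝔸] [NormedAlgebra ℂ 𝔸] [CompleteSpace 𝔸]

/-! ### Elementary numerics on `[0, 1/64]` -/

/-- `exp4_sub_one_le`: elementary real-analysis estimate for the constants. [folklore] -/
theorem exp4_sub_one_le {θ : ℝ} (h0 : 0 ≤ θ) (h1 : θ ≤ 1 / 64) : Real.exp (4 * θ) - 1 ≤ 8 * θ := by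
  have h4 : (0 : ℝ) ≤ 4 * θ := by positivity
  have := Real.abs_exp_sub_one_le (x := 4 * θ) (by rw [abs_of_nonneg h4]; linarith)
  rw [abs_of_nonneg h4] at this
  linarith [le_abs_self (Real.exp (4 * θ) - 1)]

/-- `expRem4_le`: elementary real-analysis estimate for the constants. [folklore] -/
theorem expRem4_le {θ : ℝ} (h0 : 0 ≤ θ) (h1 : θ ≤ 1 / 64) : expRem (4 * θ) ≤ 16 * θ ^ 2 := by
  have := expRem_le_sq (by positivity : 0 ≤ 4 * θ) (by linarith); nlinarith

/-- `exp_sub_one_le_of_le`: elementary real-analysis estimate for the constants. [folklore] -/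
theorem exp_sub_one_le_of_le {s θ : ℝ} (hs : s ≤ θ) (h0 : 0 ≤ θ) (h1 : θ ≤ 1 / 64) :
    Real.exp s - 1 ≤ 2 * θ := by
  have := Real.exp_le_exp.mpr hs
  have h2 := Real.abs_exp_sub_one_le (x := θ) (by rw [abs_of_nonneg h0]; linarith)
  rw [abs_of_nonneg h0] at h2
  linarith [le_abs_self (Real.exp θ - 1)]

/-- `expRem_le_sq_of_le`: elementary real-analysis estimate for the constants. [folklore] -/
theorem expRem_le_sq_of_le {s θ : ℝ} (hs0 : 0 ≤ s) (hs : s ≤ θ) (h0 : 0 ≤ θ) (h1 : θ ≤ 1 / 64) : expRem s ≤ θ ^ 2 :=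
  (expRem_mono hs0 hs).trans (expRem_le_sq h0 (by linarith))

/-! ### The norm of a contour sum; the averaging weights `L^{−d}` -/

omit [NormOneClass 𝔸] [NormedAlgebra ℂ 𝔸] [CompleteSpace 𝔸] in
/-- `|A(Γ)| ≤ |Γ| · sup |A_b|` along a word inside the region of control. [folklore] -/
theorem norm_asum_le (A : Site d → Fin d → 𝔸) (y : Site d) (R : ℕ) {a : ℝ} (ha : 0 ≤ a)
    (hA : ∀ x κ, l1 (x - y) ≤ R → ‖A x κ‖ ≤ a) :
    ∀ (w : List (Letter d)) (x : Site d), l1 (x - y) + w.length ≤ R → ‖asum A x w‖ ≤ w.length * a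
  | [], x, _ => by simp
  | l :: w, x, hx => by
    rw [List.length_cons] at hx
    have hx' : l1 (x + l.vec - y) + w.length ≤ R := by
      have := l1_add_le (x - y) l.vec
      rw [l1_vec, show x - y + l.vec = x + l.vec - y by abel] at this
      omega
    have ih := norm_asum_le A y R ha hA w (x + l.vec) hx'
    have hl : ‖stepA A x l‖ ≤ a := by
      obtain ⟨μ, b⟩ := l
      cases b
      · rw [stepA_false, norm_neg]
        simp only [Letter.vec_false, ← sub_eq_add_neg] at hx'
        exact hA _ _ (by omega)
      · rw [stepA_true]; exact hA _ _ (by omega)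
    rw [asum_cons, List.length_cons, Nat.cast_succ, add_mul, one_mul]
    exact (norm_add_le _ _).trans (by linarith)

/-- `sum_weights`: elementary real-analysis estimate for the constants. [folklore] -/
theorem sum_weights (L : ℕ) (hL : 1 ≤ L) : ∑ _r : Fin d → Fin L, ((L : ℝ) ^ d)⁻¹ = 1 := by
  rw [Finset.sum_const, Finset.card_univ, Fintype.card_fun, Fintype.card_fin, Fintype.card_fin, nsmul_eq_mul]
  have : ((L : ℝ)) ^ d ≠ 0 := pow_ne_zero _ (by exact_mod_cast (by omega : L ≠ 0))
  rw [Nat.cast_pow, mul_inv_cancel₀ this]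

omit [NormOneClass 𝔸] [CompleteSpace 𝔸] in
/-- `|Σ_x L^{−d} z_x| ≤ sup_x |z_x|` — the averaging weights of (42) are a probability vector (cf. (35)). [cite: Balaban1985Averaging, (35) p.23] -/
theorem norm_avg_le (L : ℕ) (hL : 1 ≤ L) (f : (Fin d → Fin L) → 𝔸) {K : ℝ} (hf : ∀ r, ‖f r‖ ≤ K) :
    ‖∑ r : Fin d → Fin L, ((L : ℝ) ^ d)⁻¹ • f r‖ ≤ K :=
  B7Transfer.convex_comb_norm_le _ _ _ (fun _ _ => by positivity) (sum_weights L hL) (fun r _ => hf r)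

/-! ### The bond field `A = (1/i) log V₀` in the region of control ((47) p. 25: `|A_b| ≤ O(1) L α₀`) -/

omit [NormOneClass 𝔸] in
/-- If `|V₀(b) − 1| ≤ a/2 ≤ ½` on the bonds of the region then `V₀(b) = exp A_b` with `A_b := log V₀(b)`,
`|A_b| ≤ a` (by (26)) — print p. 25 l. 3–4: "hence `V₀,b = e^{iA_b}` and `|A_b| < 2|b₋ − y|α₀ ≤ 2dLα₀`". [cite: Balaban1985Averaging, p.25 l.3–4, (26) p.21] -/
theorem bond_log {V₀ : Site d → Fin d → 𝔸ˣ} (y : Site d) (R : ℕ) {a : ℝ} (ha1 : a ≤ 1)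
    (hb : ∀ x κ, l1 (x - y) ≤ R → ‖((V₀ x κ : 𝔸ˣ) : 𝔸) - 1‖ ≤ a / 2) :
    ∀ x κ, l1 (x - y) ≤ R →
      ((V₀ x κ : 𝔸ˣ) : 𝔸) = exp (MatrixLog.mlog ((V₀ x κ : 𝔸ˣ) : 𝔸)) ∧
        ‖MatrixLog.mlog ((V₀ x κ : 𝔸ˣ) : 𝔸)‖ ≤ a := by
  intro x κ hx
  have h := hb x κ hx
  exact ⟨(MatrixLog.exp_mlog (by linarith)).symm, (MatrixLog.norm_mlog_le_two_mul (by linarith)).trans (by linarith)⟩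

/-! ### One side of `∂p′`: the expansion (49)/(50) of `V̄₀_c` to second order -/

/-- The first-order term of one averaged bond: `T_c := Σ_{x ∈ B(c₋)} L^{−d} A(Γ_{c,x})` ((47)–(48)). [cite: Balaban1985Averaging, (47)–(48) p.25] -/
def Tside (L : ℕ) (A : Site d → Fin d → 𝔸) (q : Site d) (κ : Fin d) : 𝔸 :=
  ∑ r : Fin d → Fin L, ((L : ℝ) ^ d)⁻¹ • asum A q (gammaWord L κ (boxVec L r))

/-- The first-order term of the exponent `X_c`: `Σ_x L^{−d} A(Γ_{c,x} ∪ (−c)) = Σ_x L^{−d} [A(Γ_{c,x}) − A(Γ_c)]` (p. 25). [cite: Balaban1985Averaging, p.25 (displays before (47))] -/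
def Xhat (L : ℕ) (A : Site d → Fin d → 𝔸) (q : Site d) (κ : Fin d) : 𝔸 :=
  ∑ r : Fin d → Fin L, ((L : ℝ) ^ d)⁻¹ • asum A q (gammaWord L κ (boxVec L r) ++ seg κ (-(L : ℤ)))

omit [NormOneClass 𝔸] [CompleteSpace 𝔸] in
/-- `Xhat_eq`: elementary real-analysis estimate for the constants. [folklore] -/
theorem Xhat_eq (L : ℕ) (hL : 1 ≤ L) (A : Site d → Fin d → 𝔸) (q : Site d) (κ : Fin d) :
    Xhat L A q κ = Tside L A q κ - asum A q (seg κ L) := by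
  unfold Xhat Tside
  have h : ∀ r : Fin d → Fin L, asum A q (gammaWord L κ (boxVec L r) ++ seg κ (-(L : ℤ)))
      = asum A q (gammaWord L κ (boxVec L r)) - asum A q (seg κ L) := by
    intro r
    rw [asum_append, disp_gammaWord, asum_seg_neg, add_sub_cancel_right, ← sub_eq_add_neg]
  simp_rw [h, smul_sub, Finset.sum_sub_distrib, ← Finset.sum_smul, sum_weights L hL, one_smul]

omit [NormOneClass 𝔸] in
/-- **p. 25, the displays before (47), for one side** `c = ⟨q, q + Le_κ⟩` of `∂p′`, in the gauge where `V₀ = exp A`, `|A_b| ≤ a`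
on all bonds within `l¹`-distance `R` of `y`: with `θ ≥ (2dL + 2L)·a` (≥ the length of any contour
`Γ_{c,x} ∪ (−Γ_c)` times `a`) and `θ ≤ 1/64`,
`|V̄₀_c − 1| ≤ 2θ`, `|V̄₀_c − 1 − T_c| ≤ 50θ²`, the same for `V̄₀_c⁻¹` with `−T_c`, and `|V₀(Γ_{c,x})V₀(c)⁻¹ − 1| ≤ 2θ`
(inside the analyticity domain of `log`).  The printed `O(1)(L²α₀)²` of
"`|V̄₀,c − 1 − i Σ_{x∈B(c₋)} L^{−d} A(Γ_{c,x})| < O(1)(L²α₀)²`" is `50θ²` here. [cite: Balaban1985Averaging, p.25 (displays before (47))] -/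
theorem side_estimate (V₀ : Site d → Fin d → 𝔸ˣ) (A : Site d → Fin d → 𝔸) (y : Site d) (R : ℕ) {a θ : ℝ}
    (ha : 0 ≤ a) (hVA : ∀ x κ, l1 (x - y) ≤ R → ((V₀ x κ : 𝔸ˣ) : 𝔸) = exp (A x κ) ∧ ‖A x κ‖ ≤ a)
    (L : ℕ) (hL : 1 ≤ L) (q : Site d) (κ : Fin d) (hR : l1 (q - y) + (2 * (d * L) + L + L) ≤ R)
    (hθ : ((2 * (d * L) + L + L : ℕ) : ℝ) * a ≤ θ) (hθ0 : 0 ≤ θ) (hθ1 : θ ≤ 1 / 64) :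
    ‖((bavg L V₀ q κ : 𝔸ˣ) : 𝔸) - 1‖ ≤ 2 * θ ∧
    ‖((bavg L V₀ q κ : 𝔸ˣ) : 𝔸) - 1 - Tside L A q κ‖ ≤ 50 * θ ^ 2 ∧
    ‖(((bavg L V₀ q κ)⁻¹ : 𝔸ˣ) : 𝔸) - 1‖ ≤ 2 * θ ∧
    ‖(((bavg L V₀ q κ)⁻¹ : 𝔸ˣ) : 𝔸) - 1 - (-Tside L A q κ)‖ ≤ 50 * θ ^ 2 ∧
    ∀ r : Fin d → Fin L, ‖((Wcx L V₀ q κ (boxVec L r) : 𝔸ˣ) : 𝔸) - 1‖ ≤ 2 * θ := by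
  have hA : ∀ x κ, l1 (x - y) ≤ R → ‖A x κ‖ ≤ a := fun x κ hx => (hVA x κ hx).2
  have hNa : ∀ n : ℕ, n ≤ 2 * (d * L) + L + L → (n : ℝ) * a ≤ θ := fun n hn =>
    (mul_le_mul_of_nonneg_right (by exact_mod_cast hn) ha).trans hθ
  -- (47) for the contours `Γ_{c,x} ∪ (−Γ_c)` and the logarithm (26)–(27)
  have hloop : ∀ r : Fin d → Fin L,
      ‖((Wcx L V₀ q κ (boxVec L r) : 𝔸ˣ) : 𝔸) - 1‖ ≤ 2 * θ ∧
      ‖MatrixLog.mlog ((Wcx L V₀ q κ (boxVec L r) : 𝔸ˣ) : 𝔸)‖ ≤ 4 * θ ∧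
      ‖MatrixLog.mlog ((Wcx L V₀ q κ (boxVec L r) : 𝔸ˣ) : 𝔸)
          - asum A q (gammaWord L κ (boxVec L r) ++ seg κ (-(L : ℤ)))‖ ≤ 17 * θ ^ 2 := by
    intro r
    have hlen : (gammaWord L κ (boxVec L r) ++ seg κ (-(L : ℤ))).length ≤ 2 * (d * L) + L + L := by
      rw [List.length_append, length_gammaWord, length_seg]
      have := l1_boxVec_le L r
      simp only [Int.natAbs_neg, Int.natAbs_natCast]
      omega
    obtain ⟨h1, h2⟩ := walk_linear V₀ A y R ha hVA (gammaWord L κ (boxVec L r) ++ seg κ (-(L : ℤ))) q (by omega)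
    rw [← Wcx_eq_hol_loop] at h1 h2
    have hna := hNa _ hlen
    have hW : ‖((Wcx L V₀ q κ (boxVec L r) : 𝔸ˣ) : 𝔸) - 1‖ ≤ 2 * θ :=
      h1.trans (exp_sub_one_le_of_le hna hθ0 hθ1)
    have hW' : ‖((Wcx L V₀ q κ (boxVec L r) : 𝔸ˣ) : 𝔸) - 1‖ ≤ 1 / 2 := hW.trans (by linarith)
    refine ⟨hW, (MatrixLog.norm_mlog_le_two_mul hW').trans (by linarith), ?_⟩
    have h3 := norm_mlog_sub_le hW'
    have h4 : expRem (2 * ‖((Wcx L V₀ q κ (boxVec L r) : 𝔸ˣ) : 𝔸) - 1‖) ≤ 16 * θ ^ 2 :=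
      (expRem_mono (by positivity) (by linarith)).trans (expRem4_le hθ0 hθ1)
    have h5 := expRem_le_sq_of_le (by positivity) hna hθ0 hθ1
    calc _ = ‖(MatrixLog.mlog ((Wcx L V₀ q κ (boxVec L r) : 𝔸ˣ) : 𝔸)
              - (((Wcx L V₀ q κ (boxVec L r) : 𝔸ˣ) : 𝔸) - 1))
            + ((((Wcx L V₀ q κ (boxVec L r) : 𝔸ˣ) : 𝔸) - 1)
              - asum A q (gammaWord L κ (boxVec L r) ++ seg κ (-(L : ℤ))))‖ := by rw [sub_add_sub_cancel]
      _ ≤ _ := norm_add_le _ _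
      _ ≤ 16 * θ ^ 2 + θ ^ 2 := add_le_add (h3.trans h4) (h2.trans h5)
      _ = 17 * θ ^ 2 := by ring
  -- the exponent `X_c` (42) and its first-order term
  have hXn : ‖Xavg L V₀ q κ‖ ≤ 4 * θ := norm_avg_le L hL _ fun r => (hloop r).2.1
  have hXXh : ‖Xavg L V₀ q κ - Xhat L A q κ‖ ≤ 17 * θ ^ 2 := by
    rw [Xavg, Xhat, ← Finset.sum_sub_distrib]
    simp_rw [← smul_sub]
    exact norm_avg_le L hL _ fun r => (hloop r).2.2
  have hXXh' : ‖-Xavg L V₀ q κ - -Xhat L A q κ‖ ≤ 17 * θ ^ 2 := by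
    rwa [← neg_sub', norm_neg]
  obtain ⟨hE1, hE2⟩ := norm_exp_sub_one_le_of_norm_le hXn
  obtain ⟨hE1', hE2'⟩ := norm_exp_sub_one_le_of_norm_le (show ‖-Xavg L V₀ q κ‖ ≤ 4 * θ by rwa [norm_neg])
  have hE8 : ‖exp (Xavg L V₀ q κ) - 1‖ ≤ 8 * θ := hE1.trans (exp4_sub_one_le hθ0 hθ1)
  have hE8' : ‖exp (-Xavg L V₀ q κ) - 1‖ ≤ 8 * θ := hE1'.trans (exp4_sub_one_le hθ0 hθ1)
  have hE33 : ‖exp (Xavg L V₀ q κ) - 1 - Xhat L A q κ‖ ≤ 33 * θ ^ 2 := by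
    calc _ = ‖(exp (Xavg L V₀ q κ) - 1 - Xavg L V₀ q κ) + (Xavg L V₀ q κ - Xhat L A q κ)‖ := by
            rw [sub_add_sub_cancel]
      _ ≤ _ := norm_add_le _ _
      _ ≤ 16 * θ ^ 2 + 17 * θ ^ 2 := add_le_add (hE2.trans (expRem4_le hθ0 hθ1)) hXXh
      _ = 33 * θ ^ 2 := by ring
  have hE33' : ‖exp (-Xavg L V₀ q κ) - 1 - -Xhat L A q κ‖ ≤ 33 * θ ^ 2 := by
    calc _ = ‖(exp (-Xavg L V₀ q κ) - 1 - -Xavg L V₀ q κ) + (-Xavg L V₀ q κ - -Xhat L A q κ)‖ := by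
            rw [sub_add_sub_cancel]
      _ ≤ _ := norm_add_le _ _
      _ ≤ 16 * θ ^ 2 + 17 * θ ^ 2 := add_le_add (hE2'.trans (expRem4_le hθ0 hθ1)) hXXh'
      _ = 33 * θ ^ 2 := by ring
  -- `V₀(c)` and `V₀(c)⁻¹` (47)
  have hfitY : l1 (q - y) + (seg κ (L : ℤ)).length ≤ R := by
    rw [length_seg, Int.natAbs_natCast]; omega
  obtain ⟨hY1, hY2⟩ := walk_linear V₀ A y R ha hVA (seg κ L) q hfitY
  have hLa : (((seg κ (L : ℤ)).length : ℕ) : ℝ) * a ≤ θ := hNa _ (by rw [length_seg, Int.natAbs_natCast]; omega)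
  have hY1' : ‖((hol V₀ q (seg κ L) : 𝔸ˣ) : 𝔸) - 1‖ ≤ 2 * θ := hY1.trans (exp_sub_one_le_of_le hLa hθ0 hθ1)
  have hY2' : ‖((hol V₀ q (seg κ L) : 𝔸ˣ) : 𝔸) - 1 - asum A q (seg κ L)‖ ≤ θ ^ 2 :=
    hY2.trans (expRem_le_sq_of_le (by positivity) hLa hθ0 hθ1)
  have hYinv : (hol V₀ q (seg κ (L : ℤ)))⁻¹ = hol V₀ (q + (L : ℤ) • e κ) (seg κ (-(L : ℤ))) := by
    rw [← revWord_seg, hol_revWord' V₀ (x := q) _ _ (by rw [disp_seg])]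
  have hfitZ : l1 (q + (L : ℤ) • e κ - y) + (seg κ (-(L : ℤ))).length ≤ R := by
    rw [length_seg, Int.natAbs_neg, Int.natAbs_natCast]
    have := l1_add_le (q - y) ((L : ℤ) • e κ)
    rw [l1_zsmul_e, Int.natAbs_natCast, show q - y + (L : ℤ) • e κ = q + (L : ℤ) • e κ - y by abel] at this
    omega
  obtain ⟨hZ1, hZ2⟩ := walk_linear V₀ A y R ha hVA (seg κ (-(L : ℤ))) (q + (L : ℤ) • e κ) hfitZ
  have hLa' : (((seg κ (-(L : ℤ))).length : ℕ) : ℝ) * a ≤ θ :=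
    hNa _ (by rw [length_seg, Int.natAbs_neg, Int.natAbs_natCast]; omega)
  rw [← hYinv] at hZ1 hZ2
  rw [asum_seg_neg, add_sub_cancel_right] at hZ2
  have hZ1' : ‖(((hol V₀ q (seg κ L))⁻¹ : 𝔸ˣ) : 𝔸) - 1‖ ≤ 2 * θ := hZ1.trans (exp_sub_one_le_of_le hLa' hθ0 hθ1)
  have hZ2' : ‖(((hol V₀ q (seg κ L))⁻¹ : 𝔸ˣ) : 𝔸) - 1 - -asum A q (seg κ L)‖ ≤ θ ^ 2 :=
    hZ2.trans (expRem_le_sq_of_le (by positivity) hLa' hθ0 hθ1)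
  -- `|T_c| ≤ θ`
  have hTn : ‖Tside L A q κ‖ ≤ θ := by
    refine norm_avg_le L hL _ fun r => ?_
    have hlen : (gammaWord L κ (boxVec L r)).length ≤ 2 * (d * L) + L + L := by
      rw [length_gammaWord]; have := l1_boxVec_le L r; omega
    exact (norm_asum_le A y R ha hA _ q (by omega)).trans (hNa _ hlen)
  -- the products `V̄₀_c = e^{X_c} V₀(c)` and `V̄₀_c⁻¹ = V₀(c)⁻¹ e^{−X_c}`
  have hF : ((bavg L V₀ q κ : 𝔸ˣ) : 𝔸) = exp (Xavg L V₀ q κ) * ((hol V₀ q (seg κ L) : 𝔸ˣ) : 𝔸) := rfl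
  have hFi : (((bavg L V₀ q κ)⁻¹ : 𝔸ˣ) : 𝔸) = (((hol V₀ q (seg κ L))⁻¹ : 𝔸ˣ) : 𝔸) * exp (-Xavg L V₀ q κ) := by
    simp only [bavg, mul_inv_rev, Units.val_mul, val_inv_expUnit, val_expUnit]
  have hTeq : Tside L A q κ = Xhat L A q κ + asum A q (seg κ L) := by rw [Xhat_eq L hL]; abel
  have hF2 : ‖((bavg L V₀ q κ : 𝔸ˣ) : 𝔸) - 1 - Tside L A q κ‖ ≤ 50 * θ ^ 2 := by
    rw [hF, hTeq]
    refine (norm_mul_sub_one_sub_le _ _ _ _).trans ?_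
    calc _ ≤ 8 * θ * (2 * θ) + 33 * θ ^ 2 + θ ^ 2 := by gcongr
      _ = 50 * θ ^ 2 := by ring
  have hFi2 : ‖(((bavg L V₀ q κ)⁻¹ : 𝔸ˣ) : 𝔸) - 1 - -Tside L A q κ‖ ≤ 50 * θ ^ 2 := by
    rw [hFi, hTeq, neg_add, add_comm]
    refine (norm_mul_sub_one_sub_le _ _ _ _).trans ?_
    calc _ ≤ 2 * θ * (8 * θ) + θ ^ 2 + 33 * θ ^ 2 := by gcongr
      _ = 50 * θ ^ 2 := by ring
  have hfirst : ∀ (F T : 𝔸), ‖F - 1 - T‖ ≤ 50 * θ ^ 2 → ‖T‖ ≤ θ → ‖F - 1‖ ≤ 2 * θ := by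
    intro F T h1 h2
    calc ‖F - 1‖ = ‖(F - 1 - T) + T‖ := by rw [sub_add_cancel]
      _ ≤ 50 * θ ^ 2 + θ := (norm_add_le _ _).trans (add_le_add h1 h2)
      _ ≤ 2 * θ := by nlinarith
  exact ⟨hfirst _ _ hF2 hTn, hF2, hfirst _ _ hFi2 (by rwa [norm_neg]), hFi2, fun r => (hloop r).1⟩

/-! ### Four factors: `V̄₀(∂p′) = V̄₀_{c₁} V̄₀_{c₂} V̄₀_{c₃}⁻¹ V̄₀_{c₄}⁻¹` to second order ((50)) -/

omit [NormOneClass 𝔸] [NormedAlgebra ℂ 𝔸] [CompleteSpace 𝔸] in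
/-- If `|F_i − 1| ≤ φ` and `|F_i − 1 − t_i| ≤ δ` (`i = 1..4`) then
`|F₁F₂F₃F₄ − 1 − (t₁ + t₂ + t₃ + t₄)| ≤ 4δ + φ²(6 + 4φ + φ²)` — the product step of (50). [cite: Balaban1985Averaging, (50) p.25] -/
theorem norm_prod4_sub_one_sub_le {F₁ F₂ F₃ F₄ t₁ t₂ t₃ t₄ : 𝔸} {φ δ : ℝ} (hφ : 0 ≤ φ)
    (h1 : ‖F₁ - 1‖ ≤ φ) (h2 : ‖F₂ - 1‖ ≤ φ) (h3 : ‖F₃ - 1‖ ≤ φ) (h4 : ‖F₄ - 1‖ ≤ φ)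
    (d1 : ‖F₁ - 1 - t₁‖ ≤ δ) (d2 : ‖F₂ - 1 - t₂‖ ≤ δ) (d3 : ‖F₃ - 1 - t₃‖ ≤ δ) (d4 : ‖F₄ - 1 - t₄‖ ≤ δ) :
    ‖F₁ * F₂ * F₃ * F₄ - 1 - (t₁ + t₂ + t₃ + t₄)‖ ≤ 4 * δ + φ ^ 2 * (6 + 4 * φ + φ ^ 2) := by
  have g2 : ‖F₁ * F₂ - 1‖ ≤ 2 * φ + φ ^ 2 := by
    refine (B7Prop6Bound.mul_sub_one_norm_le _ _).trans ?_
    nlinarith [norm_nonneg (F₁ - 1), norm_nonneg (F₂ - 1), mul_le_mul h1 h2 (norm_nonneg _) hφ]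
  have e2 : ‖F₁ * F₂ - 1 - (t₁ + t₂)‖ ≤ φ ^ 2 + 2 * δ := by
    refine (norm_mul_sub_one_sub_le _ _ _ _).trans ?_
    nlinarith [mul_le_mul h1 h2 (norm_nonneg _) hφ]
  have hφ2 : 0 ≤ 2 * φ + φ ^ 2 := by positivity
  have g3 : ‖F₁ * F₂ * F₃ - 1‖ ≤ 3 * φ + 3 * φ ^ 2 + φ ^ 3 := by
    refine (B7Prop6Bound.mul_sub_one_norm_le _ _).trans ?_
    have := mul_le_mul g2 h3 (norm_nonneg _) hφ2
    nlinarith [norm_nonneg (F₁ * F₂ - 1), norm_nonneg (F₃ - 1)]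
  have e3 : ‖F₁ * F₂ * F₃ - 1 - (t₁ + t₂ + t₃)‖ ≤ 3 * φ ^ 2 + φ ^ 3 + 3 * δ := by
    refine (norm_mul_sub_one_sub_le _ _ _ _).trans ?_
    have := mul_le_mul g2 h3 (norm_nonneg _) hφ2
    nlinarith
  have hφ3 : 0 ≤ 3 * φ + 3 * φ ^ 2 + φ ^ 3 := by positivity
  refine (norm_mul_sub_one_sub_le _ _ _ _).trans ?_
  have := mul_le_mul g3 h4 (norm_nonneg _) hφ3
  nlinarith

/-! ### The main term: `|Σ_x L^{−d} Σ_{p ⊂ (p′)_x} A(∂p)| ≤ L²(α₀ + ρ(4a))` ((48)–(49)) -/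

omit [NormOneClass 𝔸] in
/-- **(49)**, main term: from (44) `|exp iA(∂p) − 1| ≤ α₀` we get `|A(∂p)| ≤ α₀ + O(α₀²)` (here: `+ ρ(4a)`), hence
`|Σ_{x} L^{−d} A(∂(p′)_x)| ≤ L²α₀ + L²ρ(4a)`. [cite: Balaban1985Averaging, (49) p.25] -/
theorem main_term_bound (V₀ : Site d → Fin d → 𝔸ˣ) (A : Site d → Fin d → 𝔸) (y : Site d) (R : ℕ) {a : ℝ}
    (ha : 0 ≤ a) (hVA : ∀ x κ, l1 (x - y) ≤ R → ((V₀ x κ : 𝔸ˣ) : 𝔸) = exp (A x κ) ∧ ‖A x κ‖ ≤ a)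
    (L : ℕ) (hL : 1 ≤ L) (z : Site d) (μ ν : Fin d) {α₀ : ℝ}
    (h44 : ∀ x, ‖((hol V₀ x (plaqWord μ ν) : 𝔸ˣ) : 𝔸) - 1‖ ≤ α₀)
    (hR : ∀ (r : Fin d → Fin L) (i j : ℕ), i < L → j < L →
      l1 (z + boxVec L r + (i : ℤ) • e μ + (j : ℤ) • e ν - y) + 4 ≤ R) :
    ‖∑ r : Fin d → Fin L, ((L : ℝ) ^ d)⁻¹ • asum A (z + boxVec L r) (rectWord L L μ ν)‖
      ≤ L ^ 2 * (α₀ + expRem (4 * a)) := by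
  refine norm_avg_le L hL _ fun r => ?_
  rw [stokes]
  have hp : ∀ i ∈ Finset.range L, ∀ j ∈ Finset.range L,
      ‖asum A (z + boxVec L r + (i : ℤ) • e μ + (j : ℤ) • e ν) (plaqWord μ ν)‖ ≤ α₀ + expRem (4 * a) := by
    intro i hi j hj
    rw [Finset.mem_range] at hi hj
    obtain ⟨_, h2⟩ := walk_linear V₀ A y R ha hVA (plaqWord μ ν) _ (hR r i j hi hj)
    have hl : ((plaqWord μ ν).length : ℝ) = 4 := by simp [plaqWord]
    rw [hl] at h2
    rw [← sub_sub_cancel (((hol V₀ (z + boxVec L r + (i : ℤ) • e μ + (j : ℤ) • e ν) (plaqWord μ ν) : 𝔸ˣ) : 𝔸) - 1)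
      (asum A _ (plaqWord μ ν))]
    exact (norm_sub_le _ _).trans (add_le_add (h44 _) h2)
  calc _ ≤ ∑ i ∈ Finset.range L, ‖∑ j ∈ Finset.range L,
          asum A (z + boxVec L r + (i : ℤ) • e μ + (j : ℤ) • e ν) (plaqWord μ ν)‖ := norm_sum_le _ _
    _ ≤ ∑ i ∈ Finset.range L, ∑ j ∈ Finset.range L,
          ‖asum A (z + boxVec L r + (i : ℤ) • e μ + (j : ℤ) • e ν) (plaqWord μ ν)‖ :=
        Finset.sum_le_sum fun i _ => norm_sum_le _ _
    _ ≤ ∑ i ∈ Finset.range L, ∑ j ∈ Finset.range L, (α₀ + expRem (4 * a)) :=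
        Finset.sum_le_sum fun i hi => Finset.sum_le_sum fun j hj => hp i hi j hj
    _ = L ^ 2 * (α₀ + expRem (4 * a)) := by
        rw [Finset.sum_const, Finset.sum_const, Finset.card_range, nsmul_eq_mul, nsmul_eq_mul]; ring

/-! ### Proposition 1 in the axial gauge -/

omit [NormOneClass 𝔸] in
/-- **Proposition 1, core** (axial gauge, pp. 24–26): for a configuration `V₀` whose bond variables within
`l¹`-distance `(2d+4)L + 4` of `y = y₀ + Le_μ + Le_ν` satisfy `|V₀(b) − 1| ≤ |b₋ − y|₁ · α₀` (print p. 25: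
"for `b ⊂ Δ(p′)` we have `|V₀,b − 1| < |b₋ − y|α₀ ≤ dLα₀`"; the form proved in `axial_bond_bound`) and whose
plaquette variables satisfy (44) `|V₀(∂p) − 1| ≤ α₀` (for the plaquettes parallel to `p′`; only these enter (49)–(50)): if `θ := 8(d+1)(d+4)L²α₀ ≤ 1/64` then
`|V̄₀(∂p′) − 1| ≤ L²α₀ + 226 θ²`, and every `V₀(Γ_{c,x})V₀(c)⁻¹`, `c ⊂ ∂p′`, is within `2θ` of `1`. [cite: Balaban1985Averaging, Prop. 1 (44)–(51) pp.24–26] -/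
theorem prop1_core (L : ℕ) (hL : 1 ≤ L) (z y : Site d) {μ ν : Fin d}
    (hy : y = z + (L : ℤ) • e μ + (L : ℤ) • e ν) (V₀ : Site d → Fin d → 𝔸ˣ) {α₀ : ℝ} (hα₀ : 0 ≤ α₀)
    (hsmall : 512 * (d + 1) * (d + 4) * (L : ℝ) ^ 2 * α₀ ≤ 1)
    (h44 : ∀ x, ‖((hol V₀ x (plaqWord μ ν) : 𝔸ˣ) : 𝔸) - 1‖ ≤ α₀)
    (hbond : ∀ x κ, l1 (x - y) ≤ (2 * d + 4) * L + 4 → ‖((V₀ x κ : 𝔸ˣ) : 𝔸) - 1‖ ≤ l1 (x - y) * α₀) :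
    ‖((cplaq L (bavg L V₀) z μ ν : 𝔸ˣ) : 𝔸) - 1‖
        ≤ (L : ℝ) ^ 2 * α₀ + 226 * (8 * (d + 1) * (d + 4) * (L : ℝ) ^ 2 * α₀) ^ 2 ∧
      ∀ q κ, l1 (q - y) ≤ 2 * L → ∀ r : Fin d → Fin L, ‖((Wcx L V₀ q κ (boxVec L r) : 𝔸ˣ) : 𝔸) - 1‖ < 1 := by
  have hd : 1 ≤ d := μ.pos
  -- the constants
  set R : ℕ := (2 * d + 4) * L + 4 with hRdef
  set a : ℝ := 4 * (d + 4) * L * α₀ with hadef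
  set θ : ℝ := 8 * (d + 1) * (d + 4) * (L : ℝ) ^ 2 * α₀ with hθdef
  have hLr : (1 : ℝ) ≤ L := by exact_mod_cast hL
  have hdr : (1 : ℝ) ≤ d := by exact_mod_cast hd
  have ha : 0 ≤ a := by positivity
  have hθ0 : 0 ≤ θ := by positivity
  have hθ1 : θ ≤ 1 / 64 := by
    have : 64 * θ = 512 * (d + 1) * (d + 4) * (L : ℝ) ^ 2 * α₀ := by rw [hθdef]; ring
    linarith
  have haθ : 4 * a ≤ θ := by
    have e1 : θ - 4 * a = 8 * ((d : ℝ) + 4) * L * α₀ * ((d + 1) * L - 2) := by rw [hθdef, hadef]; ring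
    have e2 : 0 ≤ 8 * ((d : ℝ) + 4) * L * α₀ * ((d + 1) * L - 2) :=
      mul_nonneg (by positivity) (by nlinarith [mul_nonneg (sub_nonneg.mpr hdr) (by positivity : (0 : ℝ) ≤ L)])
    linarith
  have ha1 : a ≤ 1 := by linarith
  have hRa : ((R : ℕ) : ℝ) * α₀ ≤ a / 2 := by
    have e1 : a / 2 - ((R : ℕ) : ℝ) * α₀ = 4 * ((L : ℝ) - 1) * α₀ := by rw [hRdef, hadef]; push_cast; ring
    have e2 : 0 ≤ 4 * ((L : ℝ) - 1) * α₀ := mul_nonneg (mul_nonneg (by norm_num) (by linarith)) hα₀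
    linarith
  -- the bond field
  have hb : ∀ x κ, l1 (x - y) ≤ R → ‖((V₀ x κ : 𝔸ˣ) : 𝔸) - 1‖ ≤ a / 2 := fun x κ hx =>
    (hbond x κ hx).trans ((mul_le_mul_of_nonneg_right (by exact_mod_cast hx) hα₀).trans hRa)
  have hVA := bond_log y R ha1 hb
  set A : Site d → Fin d → 𝔸 := fun x κ => MatrixLog.mlog ((V₀ x κ : 𝔸ˣ) : 𝔸) with hAdef
  -- the four sides
  have hθN : ((2 * (d * L) + L + L : ℕ) : ℝ) * a ≤ θ := le_of_eq (by rw [hadef, hθdef]; push_cast; ring)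
  have hRexp : R = 2 * (d * L) + 4 * L + 4 := by rw [hRdef]; ring
  have hzy : l1 (z - y) ≤ 2 * L := by
    rw [hy, show z - (z + (L : ℤ) • e μ + (L : ℤ) • e ν) = -((L : ℤ) • e μ + (L : ℤ) • e ν) by abel, l1_neg]
    refine (l1_add_le _ _).trans ?_
    rw [l1_zsmul_e, l1_zsmul_e, Int.natAbs_natCast]; omega
  have hzμy : l1 (z + (L : ℤ) • e μ - y) ≤ 2 * L := by
    rw [hy, show z + (L : ℤ) • e μ - (z + (L : ℤ) • e μ + (L : ℤ) • e ν) = -((L : ℤ) • e ν) by abel, l1_neg,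
      l1_zsmul_e, Int.natAbs_natCast]; omega
  have hzνy : l1 (z + (L : ℤ) • e ν - y) ≤ 2 * L := by
    rw [hy, show z + (L : ℤ) • e ν - (z + (L : ℤ) • e μ + (L : ℤ) • e ν) = -((L : ℤ) • e μ) by abel, l1_neg,
      l1_zsmul_e, Int.natAbs_natCast]; omega
  have hside : ∀ q κ, l1 (q - y) ≤ 2 * L →
      ‖((bavg L V₀ q κ : 𝔸ˣ) : 𝔸) - 1‖ ≤ 2 * θ ∧
      ‖((bavg L V₀ q κ : 𝔸ˣ) : 𝔸) - 1 - Tside L A q κ‖ ≤ 50 * θ ^ 2 ∧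
      ‖(((bavg L V₀ q κ)⁻¹ : 𝔸ˣ) : 𝔸) - 1‖ ≤ 2 * θ ∧
      ‖(((bavg L V₀ q κ)⁻¹ : 𝔸ˣ) : 𝔸) - 1 - (-Tside L A q κ)‖ ≤ 50 * θ ^ 2 ∧
      ∀ r : Fin d → Fin L, ‖((Wcx L V₀ q κ (boxVec L r) : 𝔸ˣ) : 𝔸) - 1‖ ≤ 2 * θ := fun q κ hq =>
    side_estimate V₀ A y R ha hVA L hL q κ (by rw [hRexp]; omega) hθN hθ0 hθ1
  refine ⟨?_, fun q κ hq r => ((hside q κ hq).2.2.2.2 r).trans_lt (by linarith)⟩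
  obtain ⟨f1, e1, -, -, -⟩ := hside z μ hzy
  obtain ⟨f2, e2, -, -, -⟩ := hside (z + (L : ℤ) • e μ) ν hzμy
  obtain ⟨-, -, f3, e3, -⟩ := hside (z + (L : ℤ) • e ν) μ hzνy
  obtain ⟨-, -, f4, e4, -⟩ := hside z ν hzy
  have hP := norm_prod4_sub_one_sub_le (by positivity) f1 f2 f3 f4 e1 e2 e3 e4
  -- (48): the first-order terms add up to `Σ_x L^{−d} A(∂(p′)_x)`
  have hTsum : Tside L A z μ + Tside L A (z + (L : ℤ) • e μ) ν + -Tside L A (z + (L : ℤ) • e ν) μ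
      + -Tside L A z ν = ∑ r : Fin d → Fin L, ((L : ℝ) ^ d)⁻¹ • asum A (z + boxVec L r) (rectWord L L μ ν) := by
    simp only [Tside, ← Finset.sum_neg_distrib, ← Finset.sum_add_distrib, ← smul_neg, ← smul_add]
    refine Finset.sum_congr rfl fun r _ => ?_
    rw [← corner_cancellation]
    congr 1
    abel
  -- (49): the main term
  have hmain := main_term_bound V₀ A y R ha hVA L hL z μ ν h44 (fun r i j hi hj => by
    have h1 := l1_add_le (z - y) (boxVec L r + (i : ℤ) • e μ + (j : ℤ) • e ν)
    have h2 := (l1_add_le (boxVec L r + (i : ℤ) • e μ) ((j : ℤ) • e ν))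
    have h3 := (l1_add_le (boxVec L r) ((i : ℤ) • e μ))
    have h4 := l1_boxVec_le L r
    rw [l1_zsmul_e, Int.natAbs_natCast] at h2 h3
    rw [show z - y + (boxVec L r + (i : ℤ) • e μ + (j : ℤ) • e ν)
      = z + boxVec L r + (i : ℤ) • e μ + (j : ℤ) • e ν - y by abel] at h1
    rw [hRexp]; omega)
  have hρ : (L : ℝ) ^ 2 * (α₀ + expRem (4 * a)) ≤ (L : ℝ) ^ 2 * α₀ + θ ^ 2 := by
    have h1 : expRem (4 * a) ≤ (4 * a) ^ 2 := expRem_le_sq (by positivity) (by linarith)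
    have h2 : θ ^ 2 - (L : ℝ) ^ 2 * (4 * a) ^ 2 = 64 * ((d + 4) * (L : ℝ) ^ 2 * α₀) ^ 2 * ((d + 1) ^ 2 - 4) := by
      rw [hθdef, hadef]; ring
    have h3 : 0 ≤ 64 * ((d + 4) * (L : ℝ) ^ 2 * α₀) ^ 2 * (((d : ℝ) + 1) ^ 2 - 4) :=
      mul_nonneg (by positivity) (by nlinarith)
    have h4 := mul_le_mul_of_nonneg_left h1 (by positivity : (0 : ℝ) ≤ (L : ℝ) ^ 2)
    rw [mul_add]
    linarith
  -- (50): collecting terms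
  have hθ3 : θ ^ 3 ≤ θ ^ 2 / 64 := by
    calc θ ^ 3 = θ ^ 2 * θ := by ring
      _ ≤ θ ^ 2 * (1 / 64) := by gcongr
      _ = θ ^ 2 / 64 := by ring
  have hθ4 : θ ^ 4 ≤ θ ^ 2 / 64 := by
    calc θ ^ 4 = θ ^ 2 * (θ * θ) := by ring
      _ ≤ θ ^ 2 * (1 / 64 * 1) := by gcongr; linarith
      _ = θ ^ 2 / 64 := by ring
  have hcp : ((cplaq L (bavg L V₀) z μ ν : 𝔸ˣ) : 𝔸) = ((bavg L V₀ z μ : 𝔸ˣ) : 𝔸)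
      * ((bavg L V₀ (z + (L : ℤ) • e μ) ν : 𝔸ˣ) : 𝔸) * (((bavg L V₀ (z + (L : ℤ) • e ν) μ)⁻¹ : 𝔸ˣ) : 𝔸)
      * (((bavg L V₀ z ν)⁻¹ : 𝔸ˣ) : 𝔸) := by simp only [cplaq, Units.val_mul]
  rw [hcp]
  rw [hTsum] at hP
  calc _ = ‖(_ - 1 - ∑ r : Fin d → Fin L, ((L : ℝ) ^ d)⁻¹ • asum A (z + boxVec L r) (rectWord L L μ ν))
          + ∑ r : Fin d → Fin L, ((L : ℝ) ^ d)⁻¹ • asum A (z + boxVec L r) (rectWord L L μ ν)‖ := by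
          rw [sub_add_cancel]
    _ ≤ _ := norm_add_le _ _
    _ ≤ (4 * (50 * θ ^ 2) + (2 * θ) ^ 2 * (6 + 4 * (2 * θ) + (2 * θ) ^ 2))
          + (L : ℝ) ^ 2 * (α₀ + expRem (4 * a)) := add_le_add hP hmain
    _ ≤ (L : ℝ) ^ 2 * α₀ + 226 * θ ^ 2 := by linarith [sq_nonneg θ]

/-! ### Proposition 1 for an arbitrary configuration: reduction to the axial gauge by (45) -/

omit [NormedAlgebra ℂ 𝔸] [CompleteSpace 𝔸] in
/-- `norm_sub_one_le_of_conj`: elementary real-analysis estimate for the constants. [folklore] -/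
theorem norm_sub_one_le_of_conj {u X : 𝔸ˣ} (hu : u ∈ U1 𝔸) :
    ‖(X : 𝔸) - 1‖ ≤ ‖((u * X * u⁻¹ : 𝔸ˣ) : 𝔸) - 1‖ := by
  have h := norm_units_inv_conj_sub_one_le hu ((u * X * u⁻¹ : 𝔸ˣ) : 𝔸)
  have he : ((u⁻¹ : 𝔸ˣ) : 𝔸) * ((u * X * u⁻¹ : 𝔸ˣ) : 𝔸) * (u : 𝔸) = X := by
    rw [← Units.val_mul, ← Units.val_mul]; congr 1; group
  rwa [he] at h

/-- **Proposition 1 (51), kernel-checked with explicit constants.**  Let `V` be a configuration on `ℤ^d` with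
values in `{u : |u| ≤ 1, |u⁻¹| ≤ 1}` satisfying (44) `|V(∂p) − 1| ≤ α₀` for all unit plaquettes, and let
`512(d+1)(d+4)L²α₀ ≤ 1`.  Then the average (42) satisfies, for every plaquette `p′` of the `L`-lattice,
`|V̄(∂p′) − 1| ≤ L²α₀ + 226·(8(d+1)(d+4))²·(L²α₀)²` — i.e. (51) with `C₀(d) = 14464(d+1)²(d+4)²`,
`c₂′(d, L) = 1/(512(d+1)(d+4)L²)`.  Proof = the printed one (pp. 24–26): (45) to pass to the axial gauge of
B5 (1.7) at `y`, the bond bound of p. 24, (47)–(50). [cite: Balaban1985Averaging, Prop. 1 (51) p.26] -/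
theorem prop1_explicit (L : ℕ) (hL : 1 ≤ L) (z : Site d) {μ ν : Fin d} (hμν : μ ≠ ν)
    (V : Site d → Fin d → 𝔸ˣ) (hV : ∀ x κ, V x κ ∈ U1 𝔸) {α₀ : ℝ} (hα₀ : 0 ≤ α₀)
    (hsmall : 512 * (d + 1) * (d + 4) * (L : ℝ) ^ 2 * α₀ ≤ 1)
    (h44 : ∀ (x : Site d) (κ κ' : Fin d), κ ≠ κ' → ‖((hol V x (plaqWord κ κ') : 𝔸ˣ) : 𝔸) - 1‖ ≤ α₀) :
    ‖((cplaq L (bavg L V) z μ ν : 𝔸ˣ) : 𝔸) - 1‖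
      ≤ (L : ℝ) ^ 2 * α₀ + 226 * (8 * (d + 1) * (d + 4) * (L : ℝ) ^ 2 * α₀) ^ 2 := by
  set y : Site d := z + (L : ℤ) • e μ + (L : ℤ) • e ν with hy
  set u : Site d → 𝔸ˣ := axialFn V y with hu
  set V₀ : Site d → Fin d → 𝔸ˣ := gaugeAct u V with hV₀
  have huU : ∀ x, u x ∈ U1 𝔸 := fun x => axialFn_mem hV y x
  have h44₀ : ∀ x, ‖((hol V₀ x (plaqWord μ ν) : 𝔸ˣ) : 𝔸) - 1‖ ≤ α₀ := fun x => by
    rw [hV₀, hol_gaugeAct_closed _ _ _ _ (disp_plaqWord μ ν), Units.val_mul, Units.val_mul]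
    exact (norm_units_conj_sub_one_le (huU x) _).trans (h44 x μ ν hμν)
  have hbond : ∀ x κ, l1 (x - y) ≤ (2 * d + 4) * L + 4 → ‖((V₀ x κ : 𝔸ˣ) : 𝔸) - 1‖ ≤ l1 (x - y) * α₀ :=
    fun x κ _ => axial_bond_bound V hV y h44 hα₀ x κ
  obtain ⟨hcore, hW⟩ := prop1_core L hL z y hy V₀ hα₀ hsmall h44₀ hbond
  -- (45): `V̄₀_c = u(c₋) V̄_c u(c₊)⁻¹` on the four sides, hence `V̄₀(∂p′) = u(z) V̄(∂p′) u(z)⁻¹`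
  have hzy : l1 (z - y) ≤ 2 * L := by
    rw [hy, show z - (z + (L : ℤ) • e μ + (L : ℤ) • e ν) = -((L : ℤ) • e μ + (L : ℤ) • e ν) by abel, l1_neg]
    refine (l1_add_le _ _).trans ?_
    rw [l1_zsmul_e, l1_zsmul_e, Int.natAbs_natCast]; omega
  have hzμy : l1 (z + (L : ℤ) • e μ - y) ≤ 2 * L := by
    rw [hy, show z + (L : ℤ) • e μ - (z + (L : ℤ) • e μ + (L : ℤ) • e ν) = -((L : ℤ) • e ν) by abel, l1_neg,
      l1_zsmul_e, Int.natAbs_natCast]; omega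
  have hzνy : l1 (z + (L : ℤ) • e ν - y) ≤ 2 * L := by
    rw [hy, show z + (L : ℤ) • e ν - (z + (L : ℤ) • e μ + (L : ℤ) • e ν) = -((L : ℤ) • e μ) by abel, l1_neg,
      l1_zsmul_e, Int.natAbs_natCast]; omega
  have hcov : ∀ q κ, l1 (q - y) ≤ 2 * L → bavg L V₀ q κ = u q * bavg L V q κ * (u (q + (L : ℤ) • e κ))⁻¹ := by
    intro q κ hq
    rw [hV₀]
    refine bavg_gaugeAct L huU V q κ fun r => ?_
    refine (norm_sub_one_le_of_conj (X := Wcx L V q κ (boxVec L r)) (huU q)).trans_lt ?_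
    rw [← Wcx_gaugeAct]
    exact hW q κ hq r
  have hconj := cplaq_conj L u (bavg L V) (bavg L V₀) z μ ν (hcov z μ hzy) (hcov _ ν hzμy) (hcov _ μ hzνy)
    (hcov z ν hzy)
  refine (norm_sub_one_le_of_conj (X := cplaq L (bavg L V) z μ ν) (huU z)).trans ?_
  rw [← hconj]
  exact hcore

end Estimates

/-! ### The quoted leaf `B7.Prop1Printed`, instantiated -/

section Concrete

variable {𝔸 : Type} [NormedRing 𝔸] [NormOneClass 𝔸] [NormedAlgebra ℂ 𝔸] [CompleteSpace 𝔸]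

omit [NormedAlgebra ℂ 𝔸] [CompleteSpace 𝔸] in
/-- `norm_hol_sub_one_le_two`: elementary real-analysis estimate for the constants. [folklore] -/
theorem norm_hol_sub_one_le_two {V : Site d → Fin d → 𝔸ˣ} (hV : ∀ x κ, V x κ ∈ U1 𝔸) (x : Site d)
    (w : List (Letter d)) : ‖((hol V x w : 𝔸ˣ) : 𝔸) - 1‖ ≤ 2 := by
  refine (norm_sub_le _ _).trans ?_
  rw [norm_one]
  have := (hol_mem hV x w).1
  linarith

variable (𝔸) in
/-- The concrete one-step family of B7 Sect. B on `ℤ^d` (infinite volume; Prop. 1 is a local statement, p. 25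
"Let us notice that it is a local result"): index `i = (y₀, μ, ν)` = a plaquette `p′` of the `L`-lattice (lower-left corner
`y₀`, spanned by `e_μ ≠ e_ν`); `Cfg` = configurations with values in `{|u| ≤ 1, |u⁻¹| ≤ 1}` (which
contains `G = U(N) ⊂ M_N(ℂ)`); `plaqDev V = sup_p |V(∂p) − 1|` over ALL unit plaquettes (a superset of
"`p ⊂ Δ(p′)`" — see DIVERGENCES (a) in the header); `avgDev V = |V̄(∂p′) − 1|` for the average (42).
The Prop. 3 fields are not used here and are set to trivial values. [cite: Balaban1985Averaging, (42) p.23, (44) p.24, Prop. 1 p.26] -/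
def concreteOneStep (L : ℕ) (i : {p : Site d × Fin d × Fin d // p.2.1 ≠ p.2.2}) : B7.OneStep where
  Cfg := {V : Site d → Fin d → 𝔸ˣ // ∀ x κ, V x κ ∈ U1 𝔸}
  Fld := Unit
  plaqDev V := ⨆ p : Site d × Fin d × Fin d, ‖((hol V.1 p.1 (plaqWord p.2.1 p.2.2) : 𝔸ˣ) : 𝔸) - 1‖
  avgDev V := ‖((cplaq L (bavg L V.1) i.1.1 i.1.2.1 i.1.2.2 : 𝔸ˣ) : 𝔸) - 1‖
  fldNorm _ := 0
  IsAnalyticQ _ _ := True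
  remC _ _ := 0

/-- **Proposition 1 of B7 as printed (`B7.Prop1Printed`), PROVED for the concrete block average (42) on `ℤ^d`
with `G ⊂ {|u| ≤ 1, |u⁻¹| ≤ 1}` in a complete normed `ℂ`-algebra, `L ≥ 1`, `d ≥ 2`:** the printed constants may
be taken `C₀ = 14464(d+1)²(d+4)²` (depends on `d` only) and `c₂′ = 1/(512(d+1)(d+4)L²)` (depends on `d` and
`L`), exactly the dependence stated on p. 26. [cite: Balaban1985Averaging, Prop. 1 (51) p.26] -/
theorem prop1Printed_concrete (L : ℕ) (hL : 1 ≤ L) :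
    B7.Prop1Printed (L : ℝ) (concreteOneStep 𝔸 (d := d) L) := by
  refine ⟨226 * (8 * ((d : ℝ) + 1) * (d + 4)) ^ 2, 1 / (512 * ((d : ℝ) + 1) * (d + 4) * (L : ℝ) ^ 2),
    by positivity, by positivity, ?_⟩
  rintro ⟨⟨z, μ, ν⟩, hμν⟩ α₀ hα₀ hc ⟨V, hV⟩ hdev
  simp only [concreteOneStep] at hdev ⊢
  have hbdd : BddAbove (Set.range fun p : Site d × Fin d × Fin d =>
      ‖((hol V p.1 (plaqWord p.2.1 p.2.2) : 𝔸ˣ) : 𝔸) - 1‖) :=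
    ⟨2, by rintro _ ⟨p, rfl⟩; exact norm_hol_sub_one_le_two hV _ _⟩
  set s := ⨆ p : Site d × Fin d × Fin d, ‖((hol V p.1 (plaqWord p.2.1 p.2.2) : 𝔸ˣ) : 𝔸) - 1‖ with hs
  have hs0 : 0 ≤ s := Real.iSup_nonneg fun _ => norm_nonneg _
  -- an intermediate `α₁` with `plaqDev V < α₁ < α₀` gives the strict inequality (51)
  set α₁ := (s + α₀) / 2 with hα₁
  have hα₁0 : 0 ≤ α₁ := by positivity
  have hα₁α₀ : α₁ < α₀ := by rw [hα₁]; linarith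
  have hα₁α₀' : α₁ ≤ α₀ := hα₁α₀.le
  have h44 : ∀ (x : Site d) (κ κ' : Fin d), κ ≠ κ' → ‖((hol V x (plaqWord κ κ') : 𝔸ˣ) : 𝔸) - 1‖ ≤ α₁ := by
    intro x κ κ' _
    have := le_ciSup hbdd (x, κ, κ')
    simp only at this
    linarith
  have hLr : (1 : ℝ) ≤ L := by exact_mod_cast hL
  have hsmall : 512 * (d + 1) * (d + 4) * (L : ℝ) ^ 2 * α₁ ≤ 1 := by
    have hpos : 0 < 512 * ((d : ℝ) + 1) * (d + 4) * (L : ℝ) ^ 2 := by positivity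
    have h1 := (le_div_iff₀ hpos).mp hc
    have h2 := mul_le_mul_of_nonneg_left hα₁α₀' hpos.le
    linarith
  have hmain := prop1_explicit L hL z hμν V hV hα₁0 hsmall h44
  refine hmain.trans_lt ?_
  have hL2 : 0 < (L : ℝ) ^ 2 := by positivity
  have h1 : (L : ℝ) ^ 2 * α₁ < (L : ℝ) ^ 2 * α₀ := by gcongr
  have h2 : (8 * ((d : ℝ) + 1) * (d + 4) * (L : ℝ) ^ 2 * α₁) ^ 2 ≤ (8 * ((d : ℝ) + 1) * (d + 4) * (L : ℝ) ^ 2 * α₀) ^ 2 := by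
    gcongr
  nlinarith

end Concrete

end Literature.MathematicalPhysics.QuantumFieldTheory.Balaban1983to89.B7Prop1Explicit

end
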